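import Literature.Combinatorics.Optimization.PsdLiftSlackMatrix
import Literature.Combinatorics.Optimization.PsdFactorizationRescaling
import Literature.Barriers.PneNP.TSPExtensionComplexityHyperplaneBound
import Literature.Combinatorics.Optimization.BlockPsdLiftFactorization
import HarnessLib

/-!
# 0/1 polytopes with high semidefinite extension complexity (Briët–Dadush–Pokutta 2015, Theorem 7)
# and with high extension complexity (Rothvoß 2013, Theorem 4 — Part II of this file)

Source: J. Briët, D. Dadush, S. Pokutta, *On the existence of 0/1 polytopes with high semidefinite
extension complexity*, Math. Program. 153 (2015) 179–199 [BrietDadushPokutta2014]; held text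
`paper:arxiv-1305.3268` (arXiv version; "p. N" below = page/chunk N of that text, theorem numbers as
printed there and as already used by the tree for Thm. 4–6 of the same paper in
`PsdFactorizationRescaling.lean`, `BlockPsdFactorization.lean`).

Printed statements (verbatim).
* Def. 1 (§2, p. 5): "Let `K ⊆ ℝⁿ` be a convex set. A semidefinite extended formulation (semidefinite
  EF) of `K` is a system consisting of a positive integer `r`, an index set `I` and a set of triples
  `(a_i,U_i,b_i)_{i∈I} ⊆ ℝⁿ × S^r_+ × ℝ` such that `K = {x ∈ ℝⁿ | ∃Y ∈ S^r_+ : a_iᵀx + ⟨U_i,Y⟩ = b_i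
  ∀i ∈ I}`. The size of a semidefinite EF is the size `r` of the positive semidefinite matrices `U_i`.
  The semidefinite extension complexity of `K`, denoted `xc_SDP(K)`, is the minimum size of a
  semidefinite EF of `K`."
* Thm. 4 (§2, p. 5; "Yannakakis's Factorization Theorem for SDPs", = FGPRT Thm. 3.3 /
  Gouveia–Parrilo–Thomas): "Let `P ⊆ [0,1]ⁿ` be a polytope and `𝒜 = (a_i,b_i)_{i∈I}` and
  `𝒳 = (x_j)_{j∈J}` be as in Definition 2. Let `S` be the slack matrix of `P` associated with
  `(𝒜,𝒳)`. Then, `S` has a rank-`r` semidefinite factorization if and only if `P` has a semidefinite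
  EF of size `r`. That is, `rank_PSD(S) = xc_SDP(P)`."
* Lemma 2 (§4, p. 10; "Rounding lemma"): "For a positive integer `n` set `Δ := (n+1)^{(n+1)/2}`. Let
  `𝒳 ⊆ {0,1}ⁿ` be a nonempty set, let `r := xc_SDP(conv(𝒳))` and let `δ ≤ (16r³(n+r²))⁻¹`. Then, for
  every `i ∈ [n+r²]` there exist: an integer vector `a_i ∈ ℤⁿ` such that `‖a_i‖_∞ ≤ Δ`, an integer
  `b_i` such that `|b_i| ≤ Δ`, a matrix `U_i ∈ S^r_+(√(rΔ))` whose entries are integer multiples of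
  `δ/Δ` and have absolute value at most `8r^{3/2}Δ`, such that `𝒳 = {x ∈ {0,1}ⁿ | ∃Y ∈ S^r_+(√(rΔ)) :
  |b_i − a_iᵀx − ⟨Y, U_i⟩| ≤ 1/(4(n+r²)) ∀i ∈ [n+r²]}`."
* **Thm. 7** (§4, p. 11): "For any `n ∈ ℕ` there exists `𝒳 ⊆ {0,1}ⁿ` such that
  `xc_SDP(conv(𝒳)) = Ω(2^{n/4} / (n log n)^{1/4})`."  Proof (p. 11): "The construction of Lemma 2
  induces an injective map from `𝒳 ⊆ {0,1}ⁿ` to systems `(a_i, U_i, b_i)_{i∈[n+r²]}` as the set `𝒳`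
  can be reconstructed from the system. … By injectivity we cannot have more sets than distinct
  systems, i.e. `2^{2ⁿ} − 1 ≤ Δ^{(2+o(1))(n+R²+1)(n+R²)} = Δ^{(2+o(1))R⁴} = 2^{(2+o(1)) n log n R⁴}`.
  Hence for `n` large enough, `R ≥ 2^{n/4}/(3n log n)^{1/4}` as needed."

What this file PROVES (namespace `Literature.Combinatorics.Optimization`, helpers in the sub-namespace
`ZeroOneSdpLift`; `{0,1}ⁿ = Fin n → Bool` with the tree's `cubePoint`; lifts = the tree's `HasPsdLift`
of `PsdLiftSlackMatrix.lean`, i.e. FGPRT eq. (3) `P = π(S^k_+ ∩ L)`, which for polytopes has the same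
least size as Def. 1 by Thm. 4 / FGPRT Thm. 3.3 = `FawziEtAl2015_thm33_holds`):
* `ZeroOneSdpLift.two_pow_le_of_forall_hasPsdLift` — the counting inequality: if every
  `𝒳 ⊆ {0,1}ⁿ` has a psd lift of `conv(𝒳)` of size `R` (`1 ≤ n ≤ R²`, `R ≤ 2ⁿ`) then `2ⁿ ≤ 54·n·R⁴`;
* `ZeroOneSdpLift.exists_forall_not_hasPsdLift` — hence if `54·n·R⁴ < 2ⁿ` some `𝒳` has no psd lift
  of size `≤ R`; `ZeroOneSdpLift.card_le_of_forall_hasPsdLift` — "most 0/1 polytopes": a family of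
  vertex sets all of whose hulls have psd lifts of size `R` has `≤ 2^{54 n R⁴}` of the `2^{2ⁿ}` sets
  (FGPRT §9's reading of [briet2013]);
* `ZeroOneSdpLift.exists_zeroOne_two_pow_le_mul_pow_four` — for every `n ≥ 31` a nonempty
  `𝒳 ⊆ {0,1}ⁿ` all of whose psd lifts have size `k` with `2ⁿ ≤ 54·n·k⁴`, i.e.
  `k ≥ (2ⁿ/(54n))^{1/4}` (Theorem 7 WITHOUT the logarithm, see "deviations");
  `exists_zeroOne_slack_psdRank` — the same in the language of psd factorizations of slack matrices
  w.r.t. any H-description (via `FawziEtAl2015_thm33_holds`);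
* `BrietDadushPokutta2014_thm7` — the printed Theorem 7 as a named `Prop` (Ω read as
  `∃ c > 0 ∃ n₀ ∀ n ≥ n₀`), and its DISCHARGE `BrietDadushPokutta2014_thm7_holds` (`c = 1/3`, `n₀ = 31`).

Proof = the printed counting argument (§4), step by step, with these recorded DEVIATIONS:
1. (separators instead of facets) Lemma 2 starts from a non-redundant INTEGRAL FACET description of
   `conv(𝒳)` with coefficients `≤ Δ = (n+1)^{(n+1)/2}` (Hadamard bound; not in Mathlib). Its proof only
   uses that the system is integral, valid on `𝒳`, bounded, and violated (by `≥ 1`) at every 0/1 point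
   outside `𝒳`. Such a system exists trivially because 0/1 points are in convex position: the vertex
   `z` is cut off from all other cube vertices by `(2z − 𝟙)ᵀy ≤ |z| − 1` (`sepVecZ_dotProduct_le`,
   `sepVecZ_dotProduct_self`); we use these `±1` separators plus the box `0 ≤ y ≤ 1` (§S1–S2). All
   entries are then polynomial in `n, R`, which removes the factor `log n` from the exponent count and
   gives the bound without `(log n)^{1/4}`; the printed (weaker) form follows for `n ≥ 3`.
2. (weak rescaling) Thm. 6 (`‖U_i‖, ‖V^j‖ ≤ √(rΔ)`, John's theorem) is replaced by the tree's
   elementary `HasPsdFactorization.rescale_weak` (`0 ⪯ X, Y ⪯ I`, factor `r²Δ`); only constants change.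
   The lift ⇒ factorization step is the tree's `HasPsdLift.hasPsdFactorization_pairSlackMatrix`
   (FGPRT Thm. 3.3, Slater-free).
3. (entrywise rounding) the printed proof rounds `U_i` spectrally to keep `Ū_i ⪰ 0`; positivity of
   `Ū_i` is never used in the reconstruction `𝒳̄ = 𝒳`, so we round entrywise to the grid
   `η = 1/(2R²D)`, `D = n + 1 + R²`.
4. (volume-maximising subsystem) as printed (Cramer's rule, `|ν_i| ≤ 1`), on the vectors
   `(a_i, b_i, U_i)` jointly (`exists_subfamily_coeff_le_one`, via `Module.Basis.det`), so that the
   identity `Σ ν_i b_i = b_{i*}` needs no separate argument.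
Constants: `2^{2ⁿ} ≤ #codes ≤ 2^{54 n R⁴}`.

NOT here: Thm. 6 with `√(rΔ)` (see `TracialHyperplaneBoundSharp.lean`,
`HasPsdFactorization.rescale_sharp`); Thm. 8 (integral polygons); Def. 1's EF form as a separate
notion (only the psd-lift form is typed).

## Part II — the LP original (Rothvoß 2013, Theorem 4)

Source: T. Rothvoß, *Some 0/1 polytopes need exponential size extended formulations*, Math. Program.
142 (2013) 255–268 [Rothvoss2013]; held text `paper:arxiv-1105.0036` (arXiv version, "p. N" = its
pages/chunks). Printed statements (verbatim). §3 (p. 5): "An extension is a polyhedron `Q ⊆ ℝ^m`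
together with a linear projection `p : ℝ^m → ℝⁿ` such that `p(Q) = P`. An extended formulation is a
description of `Q` with linear inequalities and equations `Q = {z ∈ ℝ^m | Cz ≤ c, Dz = d}` (together
with `p`). The size of the extended formulation is the number of inequalities in the description …
Now we can define the extension complexity `xc(P)` as the smallest size of any extended formulation."
Thm. 1 (Yannakakis; p. 5): "`xc(P) = rk₊(S)`. Moreover, for any factorization `S = UV` with
`U, V ≥ 0` one can write `P = {x ∈ ℝⁿ | ∃ y ≥ 0 : Ax + Uy = b}` and for every `x_j ∈ X` one has
`Ax_j + U·V^j = b`." Lemma 2 (p. 6): "For normalized matrices, one has `‖U‖_∞ ≤ Δ` and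
`‖V‖_∞ ≤ Δ`." Thm. 3 (p. 6): "For any non-empty `X ⊆ {0,1}ⁿ`, there are matrices
`Ā ∈ ℤ^{(n+r)×n}`, `Ū ∈ ((1/(4r(n+r)Δ)) ℤ_{≥0})^{(n+r)×r}` and a vector `b̄ ∈ ℤ^{n+r}` with
`‖Ā‖_∞, ‖b̄‖_∞, ‖Ū‖_∞ ≤ Δ` such that `X = {x ∈ {0,1}ⁿ | ∃ y ∈ [0,Δ]^r : ‖Āx + Ūy − b̄‖_∞ ≤
1/(4(n+r))}`. Here is `r := xc(conv(X))` and `Δ := (√(n+1))^{n+1}`." **Thm. 4** (p. 7): "For any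
`n ∈ ℕ`, there exists a set `X ⊆ {0,1}ⁿ` such that `xc(conv(X)) ≥ Ω(2^{n/2} / √(n log(2n)))`."
Proof (p. 7): "By injectivity of `Φ`, the number of sets `X` (which is `2^{2ⁿ} − 1`) cannot be larger
than the number of systems `(Ā, Ū, b̄)`. Thus `2^{2ⁿ} − 1 ≤ (16Δ⁵)^{(n+R+1)·(n+R)} ≤
2^{C(n⁴ + n log(2n)·R²)}`."

PROVED (sub-namespace `ZeroOneLpEF`; EFs = the tree's slack-form
`Literature.Barriers.PneNP.HasEFOfSize` with `r` inequalities, FMPTW §1 "without loss of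
generality", whose least size is `xc`): `ZeroOneLpEF.exists_bounded_nonneg_factors` (Thm. 1 via the
tree's `HasEFOfSize.exists_nonneg_factorization`, `r + 1` coordinates, plus the normalisation of
Lemma 2 to `0 ≤ V ≤ 1`, `0 ≤ U ≤ 2n`), `ZeroOneLpEF.exists_code_decode_eq` (Thm. 3, `X = Y`),
`ZeroOneLpEF.two_pow_le_of_forall_hasEFOfSize` (`2ⁿ ≤ 96·n·r²` if every `𝒳` has an EF of size `r`,
`1 ≤ n ≤ r ≤ 2ⁿ`), `ZeroOneLpEF.exists_forall_not_hasEFOfSize`, `ZeroOneLpEF.card_le_of_forall_hasEFOfSize`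
("most": such a family has `≤ 2^{96 n r²}` members),
`ZeroOneLpEF.exists_zeroOne_two_pow_le_mul_sq` (for `n ≥ 20` a nonempty `𝒳` all of whose EFs have
`2ⁿ ≤ 96·n·k²`, i.e. `k ≥ (2ⁿ/(96n))^{1/2}`, Theorem 4 without the logarithm), the printed Theorem 4
as the named `Prop` `Rothvoss2013_thm4` and its DISCHARGE `Rothvoss2013_thm4_holds` (`c = 1/10`,
`n₀ = 20`). Same deviations as Part I (the `±1` separators instead of the facet description; the
volume-maximising subsystem on `(A_i, b_i, U_i)` jointly); the extra `(r+1)`-st coordinate of the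
tree's duality-based factorization (the constant `d_a − λ_aᵀg`) is immaterial for the count.
-/

noncomputable section

open Finset Matrix
open scoped MatrixOrder

namespace Literature.Combinatorics.Optimization

namespace ZeroOneSdpLift

variable {n : ℕ}

/-! ### S1. Separating a 0/1 point from the other 0/1 points with `±1` coefficients -/

/-- The `±1` normal `2z − 𝟙` of the separator of the cube vertex `z`, as an INTEGER vector. [folklore] -/
def sepVecZ (z : Fin n → Bool) : Fin n → ℤ := fun i => if z i then 1 else -1

/-- The right-hand side `|z| − 1` of the separator of `z`, an integer in `[-1, n-1]`. [folklore] -/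
def sepRhsZ (z : Fin n → Bool) : ℤ := ((univ.filter fun i => z i = true).card : ℤ) - 1

/-- `(2z − 𝟙) · y ≤ |z| − 1` for every cube vertex `y ≠ z` (and `= |z|` at `y = z`): the vertex `z`
is cut off from all other vertices of the cube by an inequality with coefficients in `{−1, 1}`
violated by exactly `1`. [folklore] -/
private theorem sepVecZ_dotProduct_cubePoint (z y : Fin n → Bool) :
    (fun i => (sepVecZ z i : ℝ)) ⬝ᵥ cubePoint y =
      ((univ.filter fun i => z i = true ∧ y i = true).card : ℝ)
        - ((univ.filter fun i => z i = false ∧ y i = true).card : ℝ) := by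
  simp only [dotProduct, sepVecZ, cubePoint]
  rw [Finset.card_filter, Finset.card_filter, Nat.cast_sum, Nat.cast_sum, ← Finset.sum_sub_distrib]
  refine Finset.sum_congr rfl fun i _ => ?_
  cases z i <;> cases y i <;> simp

/-- The separator of `z` is violated by `z` itself by exactly `1`. [folklore] -/
private theorem sepVecZ_dotProduct_self (z : Fin n → Bool) :
    (fun i => (sepVecZ z i : ℝ)) ⬝ᵥ cubePoint z = (sepRhsZ z : ℝ) + 1 := by
  rw [sepVecZ_dotProduct_cubePoint, sepRhsZ]
  have h0 : (univ.filter fun i => z i = false ∧ z i = true).card = 0 := by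
    rw [Finset.card_eq_zero, Finset.filter_eq_empty_iff]
    intro i _ h
    rw [h.2] at h
    exact Bool.noConfusion h.1
  have h1 : (univ.filter fun i => z i = true ∧ z i = true) = univ.filter fun i => z i = true := by
    ext i; simp
  rw [h0, h1]; push_cast; ring

/-- The separator of `z` is valid at every other cube vertex. [folklore] -/
private theorem sepVecZ_dotProduct_le (z y : Fin n → Bool) (h : y ≠ z) :
    (fun i => (sepVecZ z i : ℝ)) ⬝ᵥ cubePoint y ≤ (sepRhsZ z : ℝ) := by
  rw [sepVecZ_dotProduct_cubePoint, sepRhsZ]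
  -- some coordinate differs
  obtain ⟨i₀, hi₀⟩ : ∃ i, y i ≠ z i := Function.ne_iff.mp h
  -- termwise: [z ∧ y] − [¬z ∧ y] ≤ [z] − [i = i₀]
  have key : ((univ.filter fun i => z i = true ∧ y i = true).card : ℝ) + 1
      ≤ ((univ.filter fun i => z i = true).card : ℝ)
        + ((univ.filter fun i => z i = false ∧ y i = true).card : ℝ) := by
    have e1 : ((univ.filter fun i => z i = true ∧ y i = true).card : ℝ) + 1
        = ∑ i, ((if z i = true ∧ y i = true then (1 : ℝ) else 0) + if i = i₀ then 1 else 0) := by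
      rw [Finset.sum_add_distrib, Finset.card_filter, Nat.cast_sum]
      simp
    have e2 : ((univ.filter fun i => z i = true).card : ℝ)
        + ((univ.filter fun i => z i = false ∧ y i = true).card : ℝ)
        = ∑ i, ((if z i = true then (1 : ℝ) else 0) + if z i = false ∧ y i = true then 1 else 0) := by
      rw [Finset.sum_add_distrib, Finset.card_filter, Finset.card_filter, Nat.cast_sum, Nat.cast_sum]
      simp
    rw [e1, e2]
    refine Finset.sum_le_sum fun i _ => ?_
    by_cases hi : i = i₀
    · subst hi
      revert hi₀
      cases z i <;> cases y i <;> simp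
    · cases z i <;> cases y i <;> simp [hi]
  push_cast
  linarith

/-- Entries of the separator normal are `±1`. [folklore] -/
private theorem sepVecZ_mem (z : Fin n → Bool) (i : Fin n) : sepVecZ z i = 1 ∨ sepVecZ z i = -1 := by
  unfold sepVecZ; split_ifs <;> simp

/-- `-1 ≤ |z| - 1 ≤ n - 1`. [folklore] -/
private theorem sepRhsZ_bounds (z : Fin n → Bool) : -1 ≤ sepRhsZ z ∧ sepRhsZ z ≤ (n : ℤ) - 1 := by
  unfold sepRhsZ
  have : (univ.filter fun i => z i = true).card ≤ n :=
    (Finset.card_filter_le _ _).trans (by simp)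
  constructor <;> omega


/-! ### S2. The inequality system attached to a set `𝒳` of cube vertices -/

/-- Row index of the system attached to `𝒳`: one separator per cube vertex OUTSIDE `𝒳`, and the
`2n` box inequalities `y_i ≤ 1`, `-y_i ≤ 0`. [folklore] -/
abbrev Row (n : ℕ) (𝒳 : Finset (Fin n → Bool)) : Type :=
  {z : Fin n → Bool // z ∉ 𝒳} ⊕ (Fin n ⊕ Fin n)

variable (𝒳 : Finset (Fin n → Bool))

/-- Integer normals of the rows. [folklore] -/
def rowVecZ : Row n 𝒳 → Fin n → ℤ
  | Sum.inl z => sepVecZ z.1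
  | Sum.inr (Sum.inl i) => Pi.single i 1
  | Sum.inr (Sum.inr i) => -Pi.single i 1

/-- Integer right-hand sides of the rows. [folklore] -/
def rowRhsZ : Row n 𝒳 → ℤ
  | Sum.inl z => sepRhsZ z.1
  | Sum.inr (Sum.inl _) => 1
  | Sum.inr (Sum.inr _) => 0

/-- Real normals of the rows. [folklore] -/
def rowVec (j : Row n 𝒳) : Fin n → ℝ := fun i => (rowVecZ 𝒳 j i : ℝ)

/-- Real right-hand sides of the rows. [folklore] -/
def rowRhs (j : Row n 𝒳) : ℝ := (rowRhsZ 𝒳 j : ℝ)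

/-- Row normals have entries in `{-1, 0, 1}`. [folklore] -/
private theorem rowVecZ_abs_le (j : Row n 𝒳) (i : Fin n) : |rowVecZ 𝒳 j i| ≤ 1 := by
  rcases j with z | i' | i'
  · rcases sepVecZ_mem z.1 i with h | h <;> simp [rowVecZ, h]
  · by_cases h : i = i' <;> simp [rowVecZ, h]
  · by_cases h : i = i' <;> simp [rowVecZ, h]

/-- Row right-hand sides lie in `[-1, n+1]`. [folklore] -/
private theorem rowRhsZ_bounds (j : Row n 𝒳) : -1 ≤ rowRhsZ 𝒳 j ∧ rowRhsZ 𝒳 j ≤ (n : ℤ) + 1 := by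
  rcases j with z | i' | i'
  · have := sepRhsZ_bounds z.1; simp only [rowRhsZ]; omega
  · simp [rowRhsZ]
  · simp [rowRhsZ]; omega

/-- `e_i · y = y_i` for the box rows. [folklore] -/
private theorem boxVec_dotProduct (i : Fin n) (y : Fin n → ℝ) :
    (fun k => ((Pi.single i (1 : ℤ) : Fin n → ℤ) k : ℝ)) ⬝ᵥ y = y i := by
  have : (fun k => ((Pi.single i (1 : ℤ) : Fin n → ℤ) k : ℝ)) = Pi.single i (1 : ℝ) := by
    funext k; by_cases h : k = i <;> simp [h]
  rw [this, single_dotProduct, one_mul]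

/-- `-e_i · y = -y_i` for the box rows. [folklore] -/
private theorem negBoxVec_dotProduct (i : Fin n) (y : Fin n → ℝ) :
    (fun k => ((-Pi.single i (1 : ℤ) : Fin n → ℤ) k : ℝ)) ⬝ᵥ y = -y i := by
  have : (fun k => ((-Pi.single i (1 : ℤ) : Fin n → ℤ) k : ℝ)) = -Pi.single i (1 : ℝ) := by
    funext k; by_cases h : k = i <;> simp [h]
  rw [this, neg_dotProduct, single_dotProduct, one_mul]

/-- Unfolding of the separator rows. [folklore] -/
private theorem rowVec_inl (z : {z : Fin n → Bool // z ∉ 𝒳}) :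
    rowVec 𝒳 (Sum.inl z) = fun i => (sepVecZ z.1 i : ℝ) := rfl

/-- `e_i · y = y_i` for the upper box rows. [folklore] -/
private theorem rowVec_inr_inl_dotProduct (i : Fin n) (y : Fin n → ℝ) :
    rowVec 𝒳 (Sum.inr (Sum.inl i)) ⬝ᵥ y = y i := by
  unfold rowVec; exact boxVec_dotProduct i y

/-- `-e_i · y = -y_i` for the lower box rows. [folklore] -/
private theorem rowVec_inr_inr_dotProduct (i : Fin n) (y : Fin n → ℝ) :
    rowVec 𝒳 (Sum.inr (Sum.inr i)) ⬝ᵥ y = -y i := by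
  unfold rowVec; exact negBoxVec_dotProduct i y

/-- Right-hand side of a separator row. [folklore] -/
@[simp] private theorem rowRhs_inl (z : {z : Fin n → Bool // z ∉ 𝒳}) :
    rowRhs 𝒳 (Sum.inl z) = (sepRhsZ z.1 : ℝ) := rfl
/-- Right-hand side of an upper box row. [folklore] -/
@[simp] private theorem rowRhs_inr_inl (i : Fin n) : rowRhs 𝒳 (Sum.inr (Sum.inl i)) = 1 := by
  simp [rowRhs, rowRhsZ]
/-- Right-hand side of a lower box row. [folklore] -/
@[simp] private theorem rowRhs_inr_inr (i : Fin n) : rowRhs 𝒳 (Sum.inr (Sum.inr i)) = 0 := by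
  simp [rowRhs, rowRhsZ]

/-- The rows are VALID on `𝒳`. [folklore] -/
private theorem rowVec_dotProduct_le {y : Fin n → Bool} (hy : y ∈ 𝒳) (j : Row n 𝒳) :
    rowVec 𝒳 j ⬝ᵥ cubePoint y ≤ rowRhs 𝒳 j := by
  rcases j with z | i | i
  · have hne : y ≠ z.1 := fun h => z.2 (h ▸ hy)
    rw [rowVec_inl, rowRhs_inl]; exact sepVecZ_dotProduct_le z.1 y hne
  · rw [rowVec_inr_inl_dotProduct, rowRhs_inr_inl]
    unfold cubePoint; split_ifs <;> norm_num
  · rw [rowVec_inr_inr_dotProduct, rowRhs_inr_inr]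
    unfold cubePoint; split_ifs <;> norm_num

/-- The separator row of a vertex outside `𝒳` is violated by that vertex by exactly `1`. [folklore] -/
private theorem rowRhs_sub_dotProduct_self (z : {z : Fin n → Bool // z ∉ 𝒳}) :
    rowRhs 𝒳 (Sum.inl z) - rowVec 𝒳 (Sum.inl z) ⬝ᵥ cubePoint z.1 = -1 := by
  rw [rowVec_inl, rowRhs_inl, sepVecZ_dotProduct_self]; ring

/-- Slacks of the system on `𝒳` lie in `[0, 2n]` (`n ≥ 1`). [folklore] -/
private theorem slack_bounds (hn : 1 ≤ n) {y : Fin n → Bool} (hy : y ∈ 𝒳) (j : Row n 𝒳) :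
    0 ≤ rowRhs 𝒳 j - rowVec 𝒳 j ⬝ᵥ cubePoint y ∧
      rowRhs 𝒳 j - rowVec 𝒳 j ⬝ᵥ cubePoint y ≤ 2 * n := by
  refine ⟨sub_nonneg.2 (rowVec_dotProduct_le 𝒳 hy j), ?_⟩
  have hn' : (1 : ℝ) ≤ n := by exact_mod_cast hn
  rcases j with z | i | i
  · rw [rowVec_inl, rowRhs_inl, sepRhsZ, sepVecZ_dotProduct_cubePoint]
    have h1 : ((univ.filter fun i => z.1 i = true).card : ℝ) ≤ n := by
      exact_mod_cast (Finset.card_filter_le _ _).trans (by simp)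
    have h2 : ((univ.filter fun i => z.1 i = false ∧ y i = true).card : ℝ) ≤ n := by
      exact_mod_cast (Finset.card_filter_le _ _).trans (by simp)
    have h3 : (0 : ℝ) ≤ ((univ.filter fun i => z.1 i = true ∧ y i = true).card : ℝ) := by positivity
    push_cast; linarith
  · rw [rowVec_inr_inl_dotProduct, rowRhs_inr_inl]
    unfold cubePoint; split_ifs <;> linarith
  · rw [rowVec_inr_inr_dotProduct, rowRhs_inr_inr]
    unfold cubePoint; split_ifs <;> linarith

/-- The polyhedron of the system lies in the unit box, hence is bounded. [folklore] -/
private theorem isBounded_polyhedron :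
    Bornology.IsBounded {y : Fin n → ℝ | ∀ j : Row n 𝒳, rowVec 𝒳 j ⬝ᵥ y ≤ rowRhs 𝒳 j} := by
  refine (Metric.isBounded_Icc (0 : Fin n → ℝ) 1).subset fun y hy => ?_
  simp only [Set.mem_setOf_eq] at hy
  refine ⟨fun i => ?_, fun i => ?_⟩
  · have := hy (Sum.inr (Sum.inr i))
    rw [rowVec_inr_inr_dotProduct, rowRhs_inr_inr] at this
    simpa using this
  · have := hy (Sum.inr (Sum.inl i))
    rw [rowVec_inr_inl_dotProduct, rowRhs_inr_inl] at this
    simpa using this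

/-- The polyhedron of the system is convex. [folklore] -/
private theorem convex_polyhedron :
    Convex ℝ {y : Fin n → ℝ | ∀ j : Row n 𝒳, rowVec 𝒳 j ⬝ᵥ y ≤ rowRhs 𝒳 j} := by
  intro x hx y hy s t hs ht hst j
  simp only [Set.mem_setOf_eq] at hx hy
  rw [dotProduct_add, dotProduct_smul, dotProduct_smul, smul_eq_mul, smul_eq_mul]
  calc s * (rowVec 𝒳 j ⬝ᵥ x) + t * (rowVec 𝒳 j ⬝ᵥ y) ≤ s * rowRhs 𝒳 j + t * rowRhs 𝒳 j := by
        gcongr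
        · exact hx j
        · exact hy j
    _ = rowRhs 𝒳 j := by rw [← add_mul, hst, one_mul]

/-- The hull of `𝒳` lies in the polyhedron of the system. [folklore] -/
private theorem convexHull_subset_polyhedron :
    convexHull ℝ (cubePoint '' (𝒳 : Set (Fin n → Bool))) ⊆
      {y : Fin n → ℝ | ∀ j : Row n 𝒳, rowVec 𝒳 j ⬝ᵥ y ≤ rowRhs 𝒳 j} := by
  refine convexHull_min ?_ (convex_polyhedron 𝒳)
  rintro _ ⟨y, hy, rfl⟩ j
  exact rowVec_dotProduct_le 𝒳 (Finset.mem_coe.1 hy) j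

/-! ### S3. From a psd lift to entrywise-bounded psd factors of the slacks -/

/-- Entries of `P` with `0 ⪯ P ⪯ I` lie in `[-1, 1]` (`2 × 2` principal minors). [folklore] -/
private theorem abs_apply_le_one_of_posSemidef {R : ℕ} {P : Matrix (Fin R) (Fin R) ℝ} (hP : P.PosSemidef)
    (h1 : (1 - P).PosSemidef) (a b : Fin R) : |P a b| ≤ 1 := by
  have hdiag : ∀ c, P c c ≤ 1 := fun c => by
    have := h1.diag_nonneg (i := c)
    rw [Matrix.sub_apply, one_apply_eq] at this
    linarith
  have hsymm : P b a = P a b := by simpa using hP.1.apply a b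
  have hq : ∀ t : ℝ, 0 ≤ P a a * (t * t) + 2 * P a b * t + P b b := by
    intro t
    have h := (hP.submatrix ![a, b]).dotProduct_mulVec_nonneg ![t, 1]
    simp [dotProduct, mulVec, Fin.sum_univ_two] at h
    rw [hsymm] at h
    nlinarith [h]
  have h1' := hq 1
  have h2' := hq (-1)
  have := hdiag a
  have := hdiag b
  rw [abs_le]; constructor <;> nlinarith

/-- **Bounded factors.** If `conv(𝒳)` has a psd lift of size `R ≥ 1`, the slacks of the system
attached to `𝒳` factor as `b_j − a_jᵀ x = Tr(X_x U_j)` with psd `X_x` having entries in `[-1, 1]`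
and psd `U_j` having entries in `[-R²·2n, R²·2n]` (FGPRT Thm 3.3 "lift ⇒ factorization" for the
bounded polyhedron of the system, then the weak Briët–Dadush–Pokutta rescaling).
[cite: BrietDadushPokutta2014, Thm. 4 (§2, p. 5) and Thm. 6 (§3, p. 7)] -/
theorem exists_bounded_factors (hn : 1 ≤ n) {R : ℕ} (hR : 1 ≤ R)
    (h : HasPsdLift (convexHull ℝ (cubePoint '' (𝒳 : Set (Fin n → Bool)))) R) :
    ∃ (X : 𝒳 → Matrix (Fin R) (Fin R) ℝ) (U : Row n 𝒳 → Matrix (Fin R) (Fin R) ℝ),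
      (∀ x, (X x).PosSemidef ∧ ∀ a b, |X x a b| ≤ 1) ∧
      (∀ j, (U j).PosSemidef ∧ ∀ a b, |U j a b| ≤ (R : ℝ) ^ 2 * (2 * n)) ∧
      ∀ (x : 𝒳) (j : Row n 𝒳), rowRhs 𝒳 j - rowVec 𝒳 j ⬝ᵥ cubePoint x.1 = (X x * U j).trace := by
  classical
  -- enumerate points and rows by `Fin`
  set e1 := Fintype.equivFin {x // x ∈ 𝒳} with he1
  set e2 := Fintype.equivFin (Row n 𝒳) with he2
  set x' : Fin (Fintype.card {x // x ∈ 𝒳}) → (Fin n → ℝ) := fun i => cubePoint (e1.symm i).1 with hx'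
  set a' : Fin (Fintype.card (Row n 𝒳)) → (Fin n → ℝ) := fun j => rowVec 𝒳 (e2.symm j) with ha'
  set b' : Fin (Fintype.card (Row n 𝒳)) → ℝ := fun j => rowRhs 𝒳 (e2.symm j) with hb'
  have hxC : ∀ i, x' i ∈ convexHull ℝ (cubePoint '' (𝒳 : Set (Fin n → Bool))) := fun i =>
    subset_convexHull ℝ _ ⟨(e1.symm i).1, by simp, rfl⟩
  have hQeq : {y : Fin n → ℝ | ∀ j, a' j ⬝ᵥ y ≤ b' j} =
      {y : Fin n → ℝ | ∀ j : Row n 𝒳, rowVec 𝒳 j ⬝ᵥ y ≤ rowRhs 𝒳 j} := by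
    ext y
    simp only [Set.mem_setOf_eq, ha', hb']
    constructor
    · intro hy j; simpa using hy (e2 j)
    · intro hy j; exact hy _
  have hfac := HasPsdLift.hasPsdFactorization_pairSlackMatrix (x := x') (a := a') (b := b') hR h hxC
    (by rw [hQeq]; exact convexHull_subset_polyhedron 𝒳) (by rw [hQeq]; exact isBounded_polyhedron 𝒳)
  -- back to the natural index types
  set M : {x // x ∈ 𝒳} → Row n 𝒳 → ℝ := fun x j => rowRhs 𝒳 j - rowVec 𝒳 j ⬝ᵥ cubePoint x.1 with hM
  have hM' : HasPsdFactorization M R := by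
    have := hfac.submatrix e1 e2
    refine (show (fun x j => pairSlackMatrix x' a' b' (e1 x) (e2 j)) = M from ?_) ▸ this
    funext x j
    simp [pairSlackMatrix_apply, hM, hx', ha', hb']
  -- weak rescaling
  have hn1 : (1 : ℝ) ≤ n := by exact_mod_cast hn
  have hΔ : (0 : ℝ) < 2 * n := by linarith
  obtain ⟨X, Y, hX, hY, hXY⟩ := HasPsdFactorization.rescale_weak hΔ
    (fun x j => (slack_bounds 𝒳 hn (Finset.coe_mem x) j).2) hM'
  refine ⟨X, fun j => ((R : ℝ) ^ 2 * (2 * n)) • Y j, fun x => ⟨(hX x).1, fun a b =>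
    abs_apply_le_one_of_posSemidef (hX x).1 (hX x).2 a b⟩, fun j => ⟨?_, fun a b => ?_⟩, fun x j => ?_⟩
  · exact (hY j).1.smul (by positivity)
  · simp only
    rw [Matrix.smul_apply, smul_eq_mul, abs_mul, abs_of_nonneg (by positivity)]
    exact mul_le_of_le_one_right (by positivity) (abs_apply_le_one_of_posSemidef (hY j).1 (hY j).2 a b)
  · simp only
    rw [Matrix.mul_smul, trace_smul, smul_eq_mul]
    exact hXY x j


/-! ### S4. A volume-maximising subsystem (Auerbach basis; Cramer's rule) -/

open Module Submodule in
/-- **Volume-maximising subsystem.** In a finite family `w : J → E` of vectors of a finite-dimensional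
real space there are `d ≤ dim E` members `w (sel 0), …, w (sel (d-1))` such that EVERY member of the
family is a combination of them with coefficients in `[-1, 1]`: a sub-family that is a basis of the
span and maximises the volume `|det|`; the coefficient bound is Cramer's rule
(`Module.Basis.det_smul_mk_coord_eq_det_update`). This is the step "let `I' ⊆ I` be a subset of size
`|I'| = dim 𝒲` such that `vol({(a_i,U_i) : i ∈ I'})` is maximized … using Cramer's rule `|ν_i| ≤ 1`"
of the printed proof. [cite: BrietDadushPokutta2014, Lemma 2 (§4, p. 10–11, proof)] -/
theorem exists_subfamily_coeff_le_one {E : Type*} [AddCommGroup E] [Module ℝ E]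
    [FiniteDimensional ℝ E] {J : Type*} [Fintype J] (w : J → E) :
    ∃ (d : ℕ) (sel : Fin d → J), d ≤ finrank ℝ E ∧
      ∀ j, ∃ ν : Fin d → ℝ, (∀ t, |ν t| ≤ 1) ∧ w j = ∑ t, ν t • w (sel t) := by
  classical
  set W : Submodule ℝ E := span ℝ (Set.range w) with hW
  have hwW : ∀ j, w j ∈ W := fun j => subset_span ⟨j, rfl⟩
  set w' : J → W := fun j => ⟨w j, hwW j⟩ with hw'
  have hw'span : span ℝ (Set.range w') = ⊤ := by
    apply eq_top_iff.2
    rintro ⟨x, hx⟩ -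
    have : x ∈ span ℝ (Set.range (W.subtype ∘ w')) := by
      simpa [Function.comp_def, hw'] using hx
    rw [Set.range_comp, Submodule.span_image] at this
    obtain ⟨y, hy, hyx⟩ := this
    have : y = ⟨x, hx⟩ := Subtype.ext (by simpa using hyx)
    rwa [← this]
  obtain ⟨κ, ι, -, hspan, hli⟩ := exists_linearIndependent' (K := ℝ) w'
  haveI : Finite κ := hli.finite
  haveI : Fintype κ := Fintype.ofFinite κ
  set d := Fintype.card κ with hd
  have hdW : finrank ℝ W = d := by
    have h1 := finrank_span_eq_card hli
    rw [hspan, hw'span, finrank_top] at h1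
    exact h1
  let eκ : Fin d ≃ κ := (Fintype.equivFin κ).symm
  let B : Basis (Fin d) ℝ W := finBasisOfFinrankEq ℝ W hdW
  let fam : (Fin d → J) → (Fin d → W) := fun sel t => w' (sel t)
  let vol : (Fin d → J) → ℝ := fun sel => |B.det (fam sel)|
  let sel₀ : Fin d → J := fun t => ι (eκ t)
  have hsel₀ : B.det (fam sel₀) ≠ 0 := by
    have hli₀ : LinearIndependent ℝ (fam sel₀) := by
      have : fam sel₀ = (w' ∘ ι) ∘ eκ := rfl
      rw [this]
      exact hli.comp _ eκ.injective
    have hsp₀ : span ℝ (Set.range (fam sel₀)) = ⊤ := by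
      have : Set.range (fam sel₀) = Set.range (w' ∘ ι) := by
        change Set.range ((w' ∘ ι) ∘ eκ) = _
        exact eκ.surjective.range_comp _
      rw [this, hspan, hw'span]
    exact ((Module.Basis.is_basis_iff_det B).1 ⟨hli₀, hsp₀⟩).ne_zero
  obtain ⟨sel, -, hmax⟩ := exists_max_image (univ : Finset (Fin d → J)) vol ⟨sel₀, mem_univ _⟩
  have hvol : B.det (fam sel) ≠ 0 := by
    intro h0
    have := hmax sel₀ (mem_univ _)
    simp only [vol, h0, abs_zero] at this
    exact hsel₀ (abs_eq_zero.1 (le_antisymm this (abs_nonneg _)))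
  obtain ⟨hliS, hspS⟩ := (Module.Basis.is_basis_iff_det B).2 (isUnit_iff_ne_zero.2 hvol)
  let BS : Basis (Fin d) ℝ W := Basis.mk hliS hspS.ge
  have hBS : ∀ t, BS t = fam sel t := fun t => Basis.mk_apply hliS hspS.ge t
  refine ⟨d, sel, ?_, fun j => ?_⟩
  · rw [← hdW]; exact Submodule.finrank_le W
  · refine ⟨fun t => BS.coord t (w' j), fun t => ?_, ?_⟩
    · have hcr := Module.Basis.det_smul_mk_coord_eq_det_update B hliS hspS.ge t
      have hcr' : B.det (fam sel) * BS.coord t (w' j) =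
          B.det (Function.update (fam sel) t (w' j)) := by
        have := LinearMap.congr_fun hcr (w' j)
        rw [LinearMap.smul_apply, MultilinearMap.toLinearMap_apply, smul_eq_mul] at this
        exact this
      have hupd : Function.update (fam sel) t (w' j) = fam (Function.update sel t j) := by
        funext s
        by_cases hs : s = t
        · subst hs; simp [fam]
        · simp [fam, Function.update_of_ne hs]
      have hle : |B.det (Function.update (fam sel) t (w' j))| ≤ |B.det (fam sel)| := by
        rw [hupd]; exact hmax _ (mem_univ _)
      rw [← hcr', abs_mul] at hle
      have hpos : 0 < |B.det (fam sel)| := abs_pos.2 hvol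
      by_contra hcon
      rw [not_le] at hcon
      have : |B.det (fam sel)| * 1 < |B.det (fam sel)| * |BS.coord t (w' j)| :=
        mul_lt_mul_of_pos_left hcon hpos
      linarith
    · have hsum := BS.sum_repr (w' j)
      have : (w' j : E) = ∑ t, (BS.repr (w' j) t) • (fam sel t : E) := by
        conv_lhs => rw [← hsum]
        simp [hBS]
      simpa [Basis.coord_apply, fam, hw'] using this

/-! ### S5. Parameters of the encoding; rounding to a grid -/

/-- `D = n + 1 + R²`: the dimension of the coefficient space `ℝⁿ × ℝ × ℝ^{R×R}` of the rows
`(a_i, b_i, U_i)` (printed: `|I'| ≤ n + r²`). [cite: BrietDadushPokutta2014, Lemma 2 (§4, p. 10)] -/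
def dimBound (n R : ℕ) : ℕ := n + 1 + R * R

/-- `1/η = 2R²D`, the inverse grid step of the rounding. [cite: BrietDadushPokutta2014, Lemma 2 (§4, p. 10, "integer multiples of δ/Δ")] -/
def gridInv (n R : ℕ) : ℕ := 2 * (R * R) * dimBound n R

/-- The grid step `η = 1/(2R²D)`. [cite: BrietDadushPokutta2014, Lemma 2 (§4, p. 10)] -/
def gridStep (n R : ℕ) : ℝ := 1 / (gridInv n R : ℝ)

/-- `Q₀ = 4nR⁴D`: bound on the rounded entries `|U_ab/η| ≤ R²·2n·2R²D`. [cite: BrietDadushPokutta2014, Lemma 2 (§4, p. 10, "absolute value at most 8r^{3/2}Δ")] -/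
def entryBound (n R : ℕ) : ℕ := 4 * n * R ^ 4 * dimBound n R

/-- The tolerance `ε = 1/(4D)` of the decoding test (printed: `1/(4(n+r²))`). [cite: BrietDadushPokutta2014, Lemma 2 (§4, p. 10)] -/
def tol (n R : ℕ) : ℝ := 1 / (4 * (dimBound n R : ℝ))

/-- `D > 0`. [folklore] -/
private theorem dimBound_pos (n R : ℕ) : 0 < dimBound n R := by unfold dimBound; omega

/-- `1/η > 0` (`R ≥ 1`). [folklore] -/
private theorem gridInv_pos {n R : ℕ} (hR : 1 ≤ R) : 0 < gridInv n R := by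
  unfold gridInv; have := dimBound_pos n R; have : 0 < R * R := Nat.mul_pos hR hR; positivity

/-- Rounding a real to the grid `η ℤ`: the integer `round(u/η)`. [cite: BrietDadushPokutta2014, Lemma 2 (§4, p. 10–11, proof)] -/
def roundZ (n R : ℕ) (u : ℝ) : ℤ := round (u * (gridInv n R : ℝ))

/-- Rounding to the grid moves an entry by at most `η/2`. [cite: BrietDadushPokutta2014, Lemma 2 (§4, p. 10, Claim 5)] -/
theorem abs_sub_roundZ_mul {n R : ℕ} (hR : 1 ≤ R) (u : ℝ) :
    |u - (roundZ n R u : ℝ) * gridStep n R| ≤ gridStep n R / 2 := by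
  have hg : (0 : ℝ) < gridInv n R := by exact_mod_cast gridInv_pos hR
  have h := abs_sub_round (u * (gridInv n R : ℝ))
  have hη : gridStep n R = 1 / (gridInv n R : ℝ) := rfl
  have : u - (roundZ n R u : ℝ) * gridStep n R
      = (u * (gridInv n R : ℝ) - round (u * (gridInv n R : ℝ))) * gridStep n R := by
    rw [hη, roundZ]; field_simp
  have hηpos : 0 < gridStep n R := by rw [hη]; positivity
  rw [this, abs_mul, abs_of_pos hηpos, hη]
  calc |u * ↑(gridInv n R) - ↑(round (u * ↑(gridInv n R)))| * (1 / ↑(gridInv n R))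
      ≤ (1 / 2) * (1 / ↑(gridInv n R)) := by gcongr
    _ = 1 / ↑(gridInv n R) / 2 := by ring

/-- If `|u| ≤ R²·2n` then `|round(u/η)| ≤ Q₀`. [cite: BrietDadushPokutta2014, Lemma 2 (§4, p. 10–11, proof)] -/
theorem abs_roundZ_le {n R : ℕ} {u : ℝ} (hu : |u| ≤ (R : ℝ) ^ 2 * (2 * n)) :
    |roundZ n R u| ≤ (entryBound n R : ℤ) := by
  have hQ : (R : ℝ) ^ 2 * (2 * n) * (gridInv n R : ℝ) = (entryBound n R : ℝ) := by
    simp only [gridInv, entryBound, dimBound]; push_cast; ring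
  have hx : |u * (gridInv n R : ℝ)| ≤ (entryBound n R : ℝ) := by
    rw [abs_mul, abs_of_nonneg (Nat.cast_nonneg (α := ℝ) (gridInv n R)), ← hQ]
    exact mul_le_mul_of_nonneg_right hu (Nat.cast_nonneg (α := ℝ) (gridInv n R))
  obtain ⟨hx1, hx2⟩ := abs_le.1 hx
  rw [roundZ, round_eq, abs_le]
  constructor
  · rw [Int.le_floor]; push_cast; linarith
  · have : ⌊u * ↑(gridInv n R) + 1 / 2⌋ < (entryBound n R : ℤ) + 1 := by
      rw [Int.floor_lt]; push_cast; linarith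
    omega

/-- `|Tr(Y E)| ≤ R² δ` when `|Y_ab| ≤ 1` and `|E_ab| ≤ δ`. [folklore] -/
private theorem abs_trace_mul_le {R : ℕ} {Y E : Matrix (Fin R) (Fin R) ℝ} {δ : ℝ}
    (hY : ∀ a b, |Y a b| ≤ 1) (hE : ∀ a b, |E a b| ≤ δ) :
    |(Y * E).trace| ≤ (R : ℝ) ^ 2 * δ := by
  rw [Matrix.trace]
  simp only [Matrix.diag_apply, Matrix.mul_apply]
  calc |∑ a, ∑ b, Y a b * E b a| ≤ ∑ a, |∑ b, Y a b * E b a| := abs_sum_le_sum_abs _ _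
    _ ≤ ∑ a, ∑ b, |Y a b * E b a| := sum_le_sum fun a _ => abs_sum_le_sum_abs _ _
    _ ≤ ∑ _a : Fin R, ∑ _b : Fin R, δ := by
      refine sum_le_sum fun a _ => sum_le_sum fun b _ => ?_
      rw [abs_mul]
      calc |Y a b| * |E b a| ≤ 1 * δ := by
            have hδ : 0 ≤ δ := (abs_nonneg _).trans (hE b a)
            exact mul_le_mul (hY a b) (hE b a) (abs_nonneg _) zero_le_one
        _ = δ := one_mul δ
    _ = (R : ℝ) ^ 2 * δ := by simp [sq, mul_assoc]

/-! ### S6. Codes and the decoding map -/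

/-- The code of one row: `a ∈ {-1,0,1}ⁿ` (shifted by `1`), `b ∈ [-1, n+1]` (shifted by `1`) and the
rounded matrix entries `round(U_ab/η) ∈ [-Q₀, Q₀]` (shifted by `Q₀`). [cite: BrietDadushPokutta2014, Thm. 7 (§4, p. 11, proof: "each entry can take at most … values")] -/
abbrev RowCode (n R : ℕ) : Type :=
  (Fin n → Fin 3) × Fin (n + 3) × (Fin R → Fin R → Fin (2 * entryBound n R + 1))

/-- A code: the number `d ≤ D` of selected rows and `D` row codes (the first `d` are used).
[cite: BrietDadushPokutta2014, Thm. 7 (§4, p. 11, proof: "systems (a_i, U_i, b_i)_{i ∈ [n+r²]}")] -/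
abbrev Code (n R : ℕ) : Type := Fin (dimBound n R + 1) × (Fin (dimBound n R) → RowCode n R)

variable {R : ℕ}

/-- The normal vector a row code stands for. [cite: BrietDadushPokutta2014, Lemma 2 (§4, p. 10)] -/
def RowCode.vec (c : RowCode n R) : Fin n → ℝ := fun i => ((c.1 i : ℕ) : ℝ) - 1

/-- The right-hand side a row code stands for. [cite: BrietDadushPokutta2014, Lemma 2 (§4, p. 10)] -/
def RowCode.rhs (c : RowCode n R) : ℝ := ((c.2.1 : ℕ) : ℝ) - 1

/-- The (rounded) matrix `Ū` a row code stands for. [cite: BrietDadushPokutta2014, Lemma 2 (§4, p. 10)] -/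
def RowCode.mat (c : RowCode n R) : Matrix (Fin R) (Fin R) ℝ :=
  fun a b => (((c.2.2 a b : ℕ) : ℝ) - entryBound n R) * gridStep n R

/-- Admissible membership certificates: psd `Y` with entries in `[-1, 1]` (printed:
`Y ∈ S^r_+(√(rΔ))`; after the weak rescaling the point-side factors satisfy `0 ⪯ V ⪯ I`).
[cite: BrietDadushPokutta2014, Lemma 2 (§4, p. 10, the set 𝒳̄)] -/
def Admissible (Y : Matrix (Fin R) (Fin R) ℝ) : Prop := Y.PosSemidef ∧ ∀ a b, |Y a b| ≤ 1

/-- The decoding test value `b_i − a_iᵀ x − ⟨Ū_i, Y⟩` of a row code at a cube vertex and a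
certificate. [cite: BrietDadushPokutta2014, Lemma 2 (§4, p. 10, the set 𝒳̄)] -/
def testVal (c : RowCode n R) (z : Fin n → Bool) (Y : Matrix (Fin R) (Fin R) ℝ) : ℝ :=
  c.rhs - c.vec ⬝ᵥ cubePoint z - (Y * c.mat).trace

/-- **Decoding** (the set `𝒳̄` of the printed proof): the cube vertices `x` admitting a certificate
`Y` with `|b_i − a_iᵀx − ⟨Ū_i, Y⟩| ≤ ε` for all selected rows. [cite: BrietDadushPokutta2014, Lemma 2 (§4, p. 10, the set 𝒳̄)] -/
def decode (c : Code n R) : Finset (Fin n → Bool) :=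
  @Finset.filter _ (fun z => ∃ Y : Matrix (Fin R) (Fin R) ℝ, Admissible Y ∧
    ∀ t : Fin (dimBound n R), (t : ℕ) < (c.1 : ℕ) → |testVal (c.2 t) z Y| ≤ tol n R)
    (Classical.decPred _) univ

/-- Membership in the decoded set. [cite: BrietDadushPokutta2014, Lemma 2 (§4, p. 10, the set 𝒳̄)] -/
theorem mem_decode {c : Code n R} {z : Fin n → Bool} :
    z ∈ decode c ↔ ∃ Y : Matrix (Fin R) (Fin R) ℝ, Admissible Y ∧
      ∀ t : Fin (dimBound n R), (t : ℕ) < (c.1 : ℕ) → |testVal (c.2 t) z Y| ≤ tol n R := by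
  simp [decode]

/-- The number of codes. [cite: BrietDadushPokutta2014, Thm. 7 (§4, p. 11, proof)] -/
theorem card_code (n R : ℕ) :
    Fintype.card (Code n R) =
      (dimBound n R + 1) * (3 ^ n * (n + 3) * (2 * entryBound n R + 1) ^ (R * R)) ^ dimBound n R := by
  simp only [Code, RowCode, Fintype.card_prod, Fintype.card_pi, Fintype.card_fin, prod_const, card_univ]
  ring

/-! ### S7. Encoding a vertex set with a small psd lift -/

/-- Clamp an integer into `Fin m`. [folklore] -/
def clampFin (m : ℕ) (hm : 0 < m) (x : ℤ) : Fin m := ⟨x.toNat % m, Nat.mod_lt _ hm⟩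

/-- Clamping is exact on `[0, m)`. [folklore] -/
private theorem clampFin_val {m : ℕ} (hm : 0 < m) {x : ℤ} (h0 : 0 ≤ x) (hx : x < m) :
    ((clampFin m hm x : ℕ) : ℤ) = x := by
  have h1 : x.toNat < m := by omega
  simp [clampFin, Nat.mod_eq_of_lt h1, Int.toNat_of_nonneg h0]

/-- Encoding of a row from its integer data `(a, b, round(U/η))`. [cite: BrietDadushPokutta2014, Lemma 2 (§4, p. 10)] -/
def encodeRow (a : Fin n → ℤ) (b : ℤ) (q : Fin R → Fin R → ℤ) : RowCode n R :=
  (fun i => clampFin 3 (by norm_num) (a i + 1), clampFin (n + 3) (by omega) (b + 1),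
    fun s t => clampFin (2 * entryBound n R + 1) (by omega) (q s t + entryBound n R))

/-- Decoding the normal of an encoded row. [cite: BrietDadushPokutta2014, Lemma 2 (§4, p. 10)] -/
theorem encodeRow_vec {a : Fin n → ℤ} (ha : ∀ i, |a i| ≤ 1) (b : ℤ) (q : Fin R → Fin R → ℤ) :
    (encodeRow a b q).vec = fun i => (a i : ℝ) := by
  funext i
  have h := abs_le.1 (ha i)
  have := clampFin_val (m := 3) (by norm_num) (x := a i + 1) (by omega) (by omega)
  simp only [RowCode.vec, encodeRow]
  have : ((clampFin 3 (by norm_num) (a i + 1) : ℕ) : ℝ) = ((a i + 1 : ℤ) : ℝ) := by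
    exact_mod_cast this
  rw [this]; push_cast; ring

/-- Decoding the right-hand side of an encoded row. [cite: BrietDadushPokutta2014, Lemma 2 (§4, p. 10)] -/
theorem encodeRow_rhs (a : Fin n → ℤ) {b : ℤ} (hb : -1 ≤ b ∧ b ≤ (n : ℤ) + 1)
    (q : Fin R → Fin R → ℤ) : (encodeRow a b q).rhs = (b : ℝ) := by
  have := clampFin_val (m := n + 3) (by omega) (x := b + 1) (by omega) (by omega)
  simp only [RowCode.rhs, encodeRow]
  have : ((clampFin (n + 3) (by omega) (b + 1) : ℕ) : ℝ) = ((b + 1 : ℤ) : ℝ) := by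
    exact_mod_cast this
  rw [this]; push_cast; ring

/-- Decoding the rounded matrix of an encoded row. [cite: BrietDadushPokutta2014, Lemma 2 (§4, p. 10)] -/
theorem encodeRow_mat (a : Fin n → ℤ) (b : ℤ) {q : Fin R → Fin R → ℤ}
    (hq : ∀ s t, |q s t| ≤ (entryBound n R : ℤ)) :
    (encodeRow a b q).mat = fun s t => (q s t : ℝ) * gridStep n R := by
  funext s t
  have h := abs_le.1 (hq s t)
  have := clampFin_val (m := 2 * entryBound n R + 1) (by omega) (x := q s t + entryBound n R)
    (by omega) (by omega)
  simp only [RowCode.mat, encodeRow]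
  have : ((clampFin (2 * entryBound n R + 1) (by omega) (q s t + entryBound n R) : ℕ) : ℝ)
      = ((q s t + entryBound n R : ℤ) : ℝ) := by
    exact_mod_cast this
  rw [this]; push_cast; ring


/-- Linear combinations pass through the pairing with a fixed vector. [folklore] -/
private theorem sum_smul_dotProduct {d : ℕ} (ν : Fin d → ℝ) (v : Fin d → Fin n → ℝ) (x : Fin n → ℝ) :
    (∑ t, ν t • v t) ⬝ᵥ x = ∑ t, ν t * (v t ⬝ᵥ x) := by
  simp only [dotProduct, Finset.sum_apply, Pi.smul_apply, smul_eq_mul, Finset.sum_mul, Finset.mul_sum,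
    mul_assoc]
  rw [Finset.sum_comm]

/-- Linear combinations pass through `U ↦ Tr(Y U)`. [folklore] -/
private theorem trace_mul_sum_smul {d : ℕ} (ν : Fin d → ℝ) (V : Fin d → Matrix (Fin R) (Fin R) ℝ)
    (Y : Matrix (Fin R) (Fin R) ℝ) : (Y * ∑ t, ν t • V t).trace = ∑ t, ν t * (Y * V t).trace := by
  rw [Matrix.mul_sum, Matrix.trace_sum]
  refine Finset.sum_congr rfl fun t _ => ?_
  rw [Matrix.mul_smul, Matrix.trace_smul, smul_eq_mul]

/-- The dimension of the coefficient space `ℝⁿ × ℝ × ℝ^{R×R}` is `D = n + 1 + R²`. [folklore] -/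
private theorem finrank_coeffSpace (n R : ℕ) :
    Module.finrank ℝ ((Fin n → ℝ) × ℝ × Matrix (Fin R) (Fin R) ℝ) = dimBound n R := by
  simp only [Module.finrank_prod, Module.finrank_fin_fun, Module.finrank_self, Module.finrank_matrix,
    Fintype.card_fin, dimBound, mul_one]
  ring

/-- `R² · η/2 = ε`. [folklore] -/
private theorem sq_mul_half_gridStep {R : ℕ} (hR : 1 ≤ R) (n : ℕ) :
    (R : ℝ) ^ 2 * (gridStep n R / 2) = tol n R := by
  have hR' : (R : ℝ) ≠ 0 := by exact_mod_cast (Nat.one_le_iff_ne_zero.1 hR)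
  have hD : (dimBound n R : ℝ) ≠ 0 := by exact_mod_cast (dimBound_pos n R).ne'
  simp only [gridStep, tol, gridInv]
  push_cast
  field_simp
  ring

open Literature.LinearAlgebra.Matrix.NearestPositiveSemidefinite (trace_mul_nonneg) in
/-- **Encoding (injectivity of the code).** If `conv(𝒳)` has a psd lift of size `R ≥ 1` then some
code decodes to exactly `𝒳` — the identity `𝒳̄ = 𝒳` of the printed rounding lemma: members pass the
test with their own (rescaled) point factor `Y = V^x`; a non-member `x` violates its separator by `1`,
`⟨U_{i*}, Y⟩ ≥ 0` for every admissible `Y`, and writing that row as a `[-1,1]`-combination of the `d`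
selected rows forces one selected test value above `1/D − ε/… > ε`.
[cite: BrietDadushPokutta2014, Lemma 2 (§4, p. 10–11, proof of 𝒳̄ = 𝒳)] -/
theorem exists_code_decode_eq (hn : 1 ≤ n) (hR : 1 ≤ R)
    (h : HasPsdLift (convexHull ℝ (cubePoint '' (𝒳 : Set (Fin n → Bool)))) R) :
    ∃ c : Code n R, decode c = 𝒳 := by
  classical
  obtain ⟨X, U, hX, hU, hXU⟩ := exists_bounded_factors 𝒳 hn hR h
  -- rows as vectors of the coefficient space, and a volume-maximising subsystem
  set w : Row n 𝒳 → (Fin n → ℝ) × ℝ × Matrix (Fin R) (Fin R) ℝ :=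
    fun j => (rowVec 𝒳 j, rowRhs 𝒳 j, U j) with hw
  obtain ⟨d, sel, hd, hcoef⟩ := exists_subfamily_coeff_le_one w
  rw [finrank_coeffSpace] at hd
  -- rounded matrices
  set q : Row n 𝒳 → Fin R → Fin R → ℤ := fun j a b => roundZ n R (U j a b) with hq
  set Ubar : Row n 𝒳 → Matrix (Fin R) (Fin R) ℝ := fun j a b => (q j a b : ℝ) * gridStep n R
    with hUbar
  have hUerr : ∀ j a b, |(U j - Ubar j) a b| ≤ gridStep n R / 2 := fun j a b => by
    rw [Matrix.sub_apply]; exact abs_sub_roundZ_mul hR (U j a b)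
  have hqle : ∀ j a b, |q j a b| ≤ (entryBound n R : ℤ) := fun j a b => abs_roundZ_le ((hU j).2 a b)
  have htrerr : ∀ j (Y : Matrix (Fin R) (Fin R) ℝ), (∀ a b, |Y a b| ≤ 1) →
      |(Y * (U j - Ubar j)).trace| ≤ tol n R := fun j Y hY => by
    rw [← sq_mul_half_gridStep hR n]; exact abs_trace_mul_le hY (hUerr j)
  -- the code
  let row : Fin d → RowCode n R := fun t =>
    encodeRow (rowVecZ 𝒳 (sel t)) (rowRhsZ 𝒳 (sel t)) (q (sel t))
  let row₀ : RowCode n R := encodeRow (fun _ => 0) 0 (fun _ _ => 0)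
  let c : Code n R := (⟨d, by omega⟩, fun t => if ht : (t : ℕ) < d then row ⟨t, ht⟩ else row₀)
  have hrow_vec : ∀ t, (row t).vec = rowVec 𝒳 (sel t) := fun t =>
    encodeRow_vec (rowVecZ_abs_le 𝒳 (sel t)) _ _
  have hrow_rhs : ∀ t, (row t).rhs = rowRhs 𝒳 (sel t) := fun t =>
    encodeRow_rhs _ (rowRhsZ_bounds 𝒳 (sel t)) _
  have hrow_mat : ∀ t, (row t).mat = Ubar (sel t) := fun t => by
    rw [show row t = encodeRow (rowVecZ 𝒳 (sel t)) (rowRhsZ 𝒳 (sel t)) (q (sel t)) from rfl,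
      encodeRow_mat _ _ (hqle (sel t))]
  have hc2 : ∀ (t : ℕ) (ht : t < d), c.2 ⟨t, lt_of_lt_of_le ht hd⟩ = row ⟨t, ht⟩ := fun t ht => by
    simp [c, dif_pos ht]
  -- the test value of a selected row = exact slack defect + rounding error
  have htest : ∀ (t : Fin d) (z : Fin n → Bool) (Y : Matrix (Fin R) (Fin R) ℝ),
      testVal (row t) z Y =
        (rowRhs 𝒳 (sel t) - rowVec 𝒳 (sel t) ⬝ᵥ cubePoint z - (Y * U (sel t)).trace)
          + (Y * (U (sel t) - Ubar (sel t))).trace := by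
    intro t z Y
    rw [testVal, hrow_vec, hrow_rhs, hrow_mat, Matrix.mul_sub, Matrix.trace_sub]
    ring
  refine ⟨c, ?_⟩
  ext z
  rw [mem_decode]
  constructor
  · -- soundness: a certified vertex belongs to `𝒳`
    rintro ⟨Y, hYadm, hYtest⟩
    by_contra hz
    set j : Row n 𝒳 := Sum.inl ⟨z, hz⟩ with hj
    obtain ⟨ν, hν, hwj⟩ := hcoef j
    -- components of the linear relation
    have h1 : rowVec 𝒳 j = ∑ t, ν t • rowVec 𝒳 (sel t) := by
      have := congrArg Prod.fst hwj
      simpa [hw, Prod.fst_sum] using this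
    have h2 : rowRhs 𝒳 j = ∑ t, ν t * rowRhs 𝒳 (sel t) := by
      have := congrArg (fun p => p.2.1) hwj
      simpa [hw, Prod.snd_sum, Prod.fst_sum] using this
    have h3 : U j = ∑ t, ν t • U (sel t) := by
      have := congrArg (fun p => p.2.2) hwj
      simpa [hw, Prod.snd_sum] using this
    set S : Fin d → ℝ := fun t =>
      rowRhs 𝒳 (sel t) - rowVec 𝒳 (sel t) ⬝ᵥ cubePoint z - (Y * U (sel t)).trace with hS
    have hcomb : rowRhs 𝒳 j - rowVec 𝒳 j ⬝ᵥ cubePoint z - (Y * U j).trace = ∑ t, ν t * S t := by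
      rw [h1, h2, h3, sum_smul_dotProduct, trace_mul_sum_smul, ← Finset.sum_sub_distrib,
        ← Finset.sum_sub_distrib]
      refine Finset.sum_congr rfl fun t _ => ?_
      rw [hS]; ring
    have hneg : rowRhs 𝒳 j - rowVec 𝒳 j ⬝ᵥ cubePoint z = -1 := rowRhs_sub_dotProduct_self 𝒳 ⟨z, hz⟩
    have htr : 0 ≤ (Y * U j).trace := trace_mul_nonneg hYadm.1 (hU j).1
    have hone : 1 ≤ ∑ t, |S t| := by
      have hle : ∑ t, ν t * S t ≤ -1 := by rw [← hcomb]; linarith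
      calc (1 : ℝ) ≤ |∑ t, ν t * S t| := by
            rw [abs_of_nonpos (by linarith)]; linarith
        _ ≤ ∑ t, |ν t * S t| := abs_sum_le_sum_abs _ _
        _ ≤ ∑ t, |S t| := sum_le_sum fun t _ => by
            rw [abs_mul]
            exact mul_le_of_le_one_left (abs_nonneg _) (hν t)
    -- some selected row has defect ≥ 1/d ≥ 1/D
    have hdpos : 0 < d := by
      by_contra hd0
      have hd0' : d = 0 := by omega
      subst hd0'
      rw [Fintype.sum_empty] at hone
      linarith
    have hDpos : (0 : ℝ) < dimBound n R := by exact_mod_cast dimBound_pos n R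
    obtain ⟨t, -, ht⟩ : ∃ t ∈ (univ : Finset (Fin d)), 1 / (dimBound n R : ℝ) ≤ |S t| := by
      apply Finset.exists_le_of_sum_le (univ_nonempty_iff.2 ⟨⟨0, hdpos⟩⟩)
      rw [Finset.sum_const, Finset.card_univ, Fintype.card_fin, nsmul_eq_mul, mul_one_div]
      calc (d : ℝ) / dimBound n R ≤ 1 := by rw [div_le_one hDpos]; exact_mod_cast hd
        _ ≤ ∑ t, |S t| := hone
    -- but its rounded test value is within `ε = 1/(4D)`
    have hYt := hYtest ⟨t, lt_of_lt_of_le t.2 hd⟩ t.2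
    rw [hc2 t t.2, Fin.eta, htest t z Y] at hYt
    have herr := htrerr (sel t) Y hYadm.2
    have hSle : |S t| ≤ tol n R + tol n R := by
      have := abs_add_le (S t + (Y * (U (sel t) - Ubar (sel t))).trace)
        (-(Y * (U (sel t) - Ubar (sel t))).trace)
      rw [add_neg_cancel_right, abs_neg] at this
      linarith
    have htol4 : tol n R = (1 / (dimBound n R : ℝ)) / 4 := by rw [tol]; ring
    have hpos : 0 < 1 / (dimBound n R : ℝ) := by positivity
    rw [htol4] at hSle
    linarith
  · -- completeness: members are certified by their own point factor
    intro hz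
    refine ⟨X ⟨z, hz⟩, ⟨(hX _).1, (hX _).2⟩, fun t ht => ?_⟩
    have ht' : (t : ℕ) < d := by simpa [c] using ht
    have hct : c.2 t = row ⟨t, ht'⟩ := by
      have := hc2 t ht'; simpa using this
    rw [hct, htest, ← hXU ⟨z, hz⟩ (sel ⟨t, ht'⟩), sub_self, zero_add]
    exact htrerr _ _ (hX _).2


/-! ### S8. Counting -/

/-- If EVERY vertex set has a psd lift of size `R`, decoding is onto, so `2^(2^n) ≤ #codes`.
[cite: BrietDadushPokutta2014, Thm. 7 (§4, p. 11, proof: "By injectivity we cannot have more sets than distinct systems")] -/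
theorem two_pow_two_pow_le_card_code (hn : 1 ≤ n) (hR : 1 ≤ R)
    (hall : ∀ 𝒳 : Finset (Fin n → Bool),
      HasPsdLift (convexHull ℝ (cubePoint '' (𝒳 : Set (Fin n → Bool)))) R) :
    2 ^ (2 ^ n) ≤ Fintype.card (Code n R) := by
  classical
  have hsurj : Function.Surjective (decode : Code n R → Finset (Fin n → Bool)) := fun 𝒳 =>
    exists_code_decode_eq 𝒳 hn hR (hall 𝒳)
  have := Fintype.card_le_of_surjective _ hsurj
  rwa [Fintype.card_finset, Fintype.card_fun, Fintype.card_bool, Fintype.card_fin] at this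

/-- `54 n⁵ < 2ⁿ` for `n ≥ 31`. [folklore] -/
private theorem fiftyfour_mul_pow_five_lt_two_pow {n : ℕ} (hn : 31 ≤ n) : 54 * n ^ 5 < 2 ^ n := by
  induction n, hn using Nat.le_induction with
  | base => norm_num
  | succ m hm ih =>
    have h1 : 1 ≤ m := by omega
    have e5 : (m + 1) ^ 5 = m ^ 5 + 5 * m ^ 4 + 10 * m ^ 3 + 10 * m ^ 2 + 5 * m + 1 := by ring
    have h4 : 31 * m ^ 4 ≤ m ^ 5 := by
      rw [pow_succ]; rw [mul_comm]; exact Nat.mul_le_mul_left _ hm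
    have h3 : m ^ 3 ≤ m ^ 4 := Nat.pow_le_pow_right h1 (by norm_num)
    have h2 : m ^ 2 ≤ m ^ 4 := Nat.pow_le_pow_right h1 (by norm_num)
    have h1' : m ≤ m ^ 4 := by
      calc m = m ^ 1 := (pow_one m).symm
        _ ≤ m ^ 4 := Nat.pow_le_pow_right h1 (by norm_num)
    have h0 : 1 ≤ m ^ 4 := Nat.one_le_pow _ _ h1
    have : (m + 1) ^ 5 ≤ 2 * m ^ 5 := by rw [e5]; omega
    calc 54 * (m + 1) ^ 5 ≤ 54 * (2 * m ^ 5) := Nat.mul_le_mul_left _ this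
      _ = 2 * (54 * m ^ 5) := by ring
      _ < 2 * 2 ^ m := by omega
      _ = 2 ^ (m + 1) := by rw [pow_succ]; ring

/-- The number of codes is at most `2^(54 n R⁴)` (`1 ≤ n ≤ R²`, `R ≤ 2ⁿ`). [cite: BrietDadushPokutta2014, Thm. 7 (§4, p. 11, proof: "`Δ^{(2+o(1))(n+R²+1)(n+R²)} = 2^{(2+o(1)) n log n R⁴}`")] -/
theorem card_code_le_two_pow (hn : 1 ≤ n) (hR : 1 ≤ R) (hnR : n ≤ R * R) (hR2 : R ≤ 2 ^ n) :
    Fintype.card (Code n R) ≤ 2 ^ (54 * n * R ^ 4) := by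
  rw [card_code]
  have hRR : 1 ≤ R * R := Nat.mul_le_mul hR hR
  have hR4 : R ^ 4 = R * R * (R * R) := by ring
  -- the dimension bound
  have hD3 : dimBound n R ≤ 3 * (R * R) := by unfold dimBound; omega
  have hn2 : n + 1 ≤ 2 ^ n := Nat.lt_two_pow_self
  have hRsq : R * R ≤ 2 ^ (2 * n) := by
    calc R * R ≤ 2 ^ n * 2 ^ n := Nat.mul_le_mul hR2 hR2
      _ = 2 ^ (2 * n) := by rw [← pow_add]; ring_nf
  have hD2 : dimBound n R ≤ 2 ^ (2 * n + 1) := by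
    have : 2 ^ n ≤ 2 ^ (2 * n) := Nat.pow_le_pow_right (by norm_num) (by omega)
    unfold dimBound
    calc n + 1 + R * R ≤ 2 ^ (2 * n) + 2 ^ (2 * n) := Nat.add_le_add (hn2.trans this) hRsq
      _ = 2 ^ (2 * n + 1) := by rw [pow_succ]; ring
  have hRfour : R ^ 4 ≤ 2 ^ (4 * n) := by
    calc R ^ 4 ≤ (2 ^ n) ^ 4 := Nat.pow_le_pow_left hR2 4
      _ = 2 ^ (4 * n) := by rw [← pow_mul]; ring_nf
  have hnn : n ≤ 2 ^ n := by omega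
  -- the grid range
  have hK : 2 * entryBound n R + 1 ≤ 2 ^ (7 * n + 5) := by
    unfold entryBound
    have : 2 * (4 * n * R ^ 4 * dimBound n R) ≤ 2 ^ (7 * n + 4) := by
      calc 2 * (4 * n * R ^ 4 * dimBound n R) = 8 * (n * (R ^ 4 * dimBound n R)) := by ring
        _ ≤ 8 * (2 ^ n * (2 ^ (4 * n) * 2 ^ (2 * n + 1))) := by gcongr
        _ = 2 ^ (7 * n + 4) := by
          rw [show (8 : ℕ) = 2 ^ 3 by norm_num, ← pow_add, ← pow_add, ← pow_add]; ring_nf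
    have h1 : 1 ≤ 2 ^ (7 * n + 4) := Nat.one_le_two_pow
    calc 2 * (4 * n * R ^ 4 * dimBound n R) + 1 ≤ 2 ^ (7 * n + 4) + 2 ^ (7 * n + 4) := by omega
      _ = 2 ^ (7 * n + 5) := by rw [pow_succ]; ring
  -- the factors of one row code
  have h3 : 3 ^ n ≤ 2 ^ (2 * n) := by
    calc 3 ^ n ≤ 4 ^ n := Nat.pow_le_pow_left (by norm_num) n
      _ = 2 ^ (2 * n) := by rw [pow_mul]; norm_num
  have hn3 : n + 3 ≤ 2 ^ (n + 2) := by
    have : 2 ^ (n + 2) = 4 * 2 ^ n := by rw [pow_add]; ring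
    omega
  have hexp : 2 * n + (n + 2) + (7 * n + 5) * (R * R) ≤ 17 * n * (R * R) := by nlinarith
  have hinner : 3 ^ n * (n + 3) * (2 * entryBound n R + 1) ^ (R * R) ≤ 2 ^ (17 * n * (R * R)) := by
    calc 3 ^ n * (n + 3) * (2 * entryBound n R + 1) ^ (R * R)
        ≤ 2 ^ (2 * n) * 2 ^ (n + 2) * (2 ^ (7 * n + 5)) ^ (R * R) := by
          gcongr
      _ = 2 ^ (2 * n + (n + 2) + (7 * n + 5) * (R * R)) := by
          rw [← pow_mul, ← pow_add, ← pow_add]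
      _ ≤ 2 ^ (17 * n * (R * R)) := Nat.pow_le_pow_right (by norm_num) hexp
  have hpowD : (3 ^ n * (n + 3) * (2 * entryBound n R + 1) ^ (R * R)) ^ dimBound n R
      ≤ 2 ^ (51 * n * R ^ 4) := by
    calc (3 ^ n * (n + 3) * (2 * entryBound n R + 1) ^ (R * R)) ^ dimBound n R
        ≤ (2 ^ (17 * n * (R * R))) ^ dimBound n R := Nat.pow_le_pow_left hinner _
      _ = 2 ^ (17 * n * (R * R) * dimBound n R) := by rw [← pow_mul]
      _ ≤ 2 ^ (51 * n * R ^ 4) := Nat.pow_le_pow_right (by norm_num) (by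
          rw [hR4]
          calc 17 * n * (R * R) * dimBound n R ≤ 17 * n * (R * R) * (3 * (R * R)) :=
                Nat.mul_le_mul_left _ hD3
            _ = 51 * n * (R * R * (R * R)) := by ring)
  have hD1 : dimBound n R + 1 ≤ 2 ^ (3 * n * R ^ 4) := by
    calc dimBound n R + 1 ≤ 2 ^ dimBound n R := Nat.lt_two_pow_self
      _ ≤ 2 ^ (3 * n * R ^ 4) := Nat.pow_le_pow_right (by norm_num) (by
          rw [hR4]
          calc dimBound n R ≤ 3 * (R * R) := hD3
            _ = 3 * 1 * (R * R * 1) := by ring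
            _ ≤ 3 * n * (R * R * (R * R)) := by gcongr)
  calc (dimBound n R + 1) * (3 ^ n * (n + 3) * (2 * entryBound n R + 1) ^ (R * R)) ^ dimBound n R
      ≤ 2 ^ (3 * n * R ^ 4) * 2 ^ (51 * n * R ^ 4) := Nat.mul_le_mul hD1 hpowD
    _ = 2 ^ (54 * n * R ^ 4) := by rw [← pow_add]; ring_nf

/-! ### S9. The theorems -/

/-- **Counting bound.** If every `𝒳 ⊆ {0,1}ⁿ` has a psd lift of `conv(𝒳)` of size `R`
(`1 ≤ n ≤ R²`, `R ≤ 2ⁿ`), then `2ⁿ ≤ 54·n·R⁴`. [cite: BrietDadushPokutta2014, Thm. 7 (§4, p. 11, proof)] -/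
theorem two_pow_le_of_forall_hasPsdLift (hn : 1 ≤ n) (hR : 1 ≤ R) (hnR : n ≤ R * R)
    (hR2 : R ≤ 2 ^ n)
    (hall : ∀ 𝒳 : Finset (Fin n → Bool),
      HasPsdLift (convexHull ℝ (cubePoint '' (𝒳 : Set (Fin n → Bool)))) R) :
    2 ^ n ≤ 54 * n * R ^ 4 :=
  (Nat.pow_le_pow_iff_right (by norm_num)).1
    ((two_pow_two_pow_le_card_code hn hR hall).trans (card_code_le_two_pow hn hR hnR hR2))

/-- **Existence of a vertex set without small psd lifts.** If `1 ≤ n ≤ R²` and `54·n·R⁴ < 2ⁿ`, some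
`𝒳 ⊆ {0,1}ⁿ` has NO psd lift of `conv(𝒳)` of any size `k ≤ R`.
[cite: BrietDadushPokutta2014, Thm. 7 (§4, p. 11)] -/
theorem exists_forall_not_hasPsdLift (hn : 1 ≤ n) (hR : 1 ≤ R) (hnR : n ≤ R * R)
    (hlt : 54 * n * R ^ 4 < 2 ^ n) :
    ∃ 𝒳 : Finset (Fin n → Bool), ∀ k ≤ R,
      ¬ HasPsdLift (convexHull ℝ (cubePoint '' (𝒳 : Set (Fin n → Bool)))) k := by
  by_contra hcon
  push Not at hcon
  have hall : ∀ 𝒳 : Finset (Fin n → Bool),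
      HasPsdLift (convexHull ℝ (cubePoint '' (𝒳 : Set (Fin n → Bool)))) R := fun 𝒳 => by
    obtain ⟨k, hk, h⟩ := hcon 𝒳
    exact h.mono hk
  have hR2 : R ≤ 2 ^ n := by
    have h1 : R ≤ R ^ 4 := by
      calc R = R ^ 1 := (pow_one R).symm
        _ ≤ R ^ 4 := Nat.pow_le_pow_right hR (by norm_num)
    have h2 : R ^ 4 ≤ 54 * n * R ^ 4 := Nat.le_mul_of_pos_left _ (by omega)
    omega
  exact absurd (two_pow_le_of_forall_hasPsdLift hn hR hnR hR2 hall) (not_le.2 hlt)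

/-- **"Most 0/1 polytopes have high psd rank"** — the quantitative content of the counting proof
(FGPRT §9: "It was shown in [briet2013] that as `n` grows, most 0/1-polytopes of dimension `n` must
have psd rank exponential in `n`. The proof works via a counting argument"): a family of vertex sets
`𝒳 ⊆ {0,1}ⁿ` all of whose hulls have a psd lift of size `R` (`1 ≤ n ≤ R²`, `R ≤ 2ⁿ`) has at most
`2^{54 n R⁴}` members — out of `2^{2ⁿ}` vertex sets.
[cite: BrietDadushPokutta2014, Thm. 7 (§4, p. 11, proof)] [cite: FawziEtAl2015, §9 (p25)] -/
theorem card_le_of_forall_hasPsdLift (hn : 1 ≤ n) (hR : 1 ≤ R) (hnR : n ≤ R * R) (hR2 : R ≤ 2 ^ n)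
    (𝓕 : Finset (Finset (Fin n → Bool)))
    (h𝓕 : ∀ 𝒳 ∈ 𝓕, HasPsdLift (convexHull ℝ (cubePoint '' (𝒳 : Set (Fin n → Bool)))) R) :
    𝓕.card ≤ 2 ^ (54 * n * R ^ 4) := by
  classical
  have hsub : 𝓕 ⊆ (Finset.univ : Finset (Code n R)).image decode := fun 𝒳 h𝒳 => by
    obtain ⟨c, hc⟩ := exists_code_decode_eq 𝒳 hn hR (h𝓕 𝒳 h𝒳)
    exact Finset.mem_image.2 ⟨c, Finset.mem_univ _, hc⟩
  calc 𝓕.card ≤ ((Finset.univ : Finset (Code n R)).image decode).card := Finset.card_le_card hsub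
    _ ≤ (Finset.univ : Finset (Code n R)).card := Finset.card_image_le
    _ = Fintype.card (Code n R) := Finset.card_univ
    _ ≤ 2 ^ (54 * n * R ^ 4) := card_code_le_two_pow hn hR hnR hR2

/-- The hull of a NONEMPTY vertex set is nonempty, so it has no psd lift "of the empty set";
conversely the empty vertex set has psd lifts of every size. [folklore] -/
private theorem hasPsdLift_empty_cube (n k : ℕ) :
    HasPsdLift (convexHull ℝ (cubePoint '' ((∅ : Finset (Fin n → Bool)) : Set (Fin n → Bool)))) k := by
  simp only [Finset.coe_empty, Set.image_empty, convexHull_empty]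
  exact hasPsdLift_empty k

/-- **Briët–Dadush–Pokutta, Theorem 7 — explicit form without the logarithm.** For every `n ≥ 31`
there is a nonempty `𝒳 ⊆ {0,1}ⁿ` such that every psd lift of `conv(𝒳)` has size `k` with
`2ⁿ ≤ 54·n·k⁴`, i.e. `k ≥ (2ⁿ/(54 n))^{1/4}`. (The printed bound has `(n log n)^{1/4}` in the
denominator; the logarithm came from the integral facet description with coefficients
`≤ (n+1)^{(n+1)/2}`, which the `±1` separators of §S1 avoid.)
[cite: BrietDadushPokutta2014, Thm. 7 (§4, p. 11)] -/
theorem exists_zeroOne_two_pow_le_mul_pow_four (hn : 31 ≤ n) :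
    ∃ 𝒳 : Finset (Fin n → Bool), 𝒳.Nonempty ∧
      ∀ k : ℕ, HasPsdLift (convexHull ℝ (cubePoint '' (𝒳 : Set (Fin n → Bool)))) k →
        2 ^ n ≤ 54 * n * k ^ 4 := by
  classical
  have hn1 : 1 ≤ n := by omega
  set P : ℕ → Prop := fun R => 54 * n * R ^ 4 < 2 ^ n with hP
  set R₀ := Nat.findGreatest P (2 ^ n) with hR₀
  have hPn : P n := by
    show 54 * n * n ^ 4 < 2 ^ n
    calc 54 * n * n ^ 4 = 54 * n ^ 5 := by ring
      _ < 2 ^ n := fiftyfour_mul_pow_five_lt_two_pow hn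
  have hnR₀ : n ≤ R₀ := Nat.le_findGreatest (Nat.lt_two_pow_self).le hPn
  have hR₀1 : 1 ≤ R₀ := hn1.trans hnR₀
  have hPR₀ : P R₀ := Nat.findGreatest_spec (P := P) (Nat.zero_le _) (by
    show 54 * n * 0 ^ 4 < 2 ^ n; simp)
  obtain ⟨𝒳, h𝒳⟩ := exists_forall_not_hasPsdLift hn1 hR₀1
    (hnR₀.trans (Nat.le_mul_of_pos_right _ (by omega))) hPR₀
  refine ⟨𝒳, ?_, fun k hk => ?_⟩
  · rw [Finset.nonempty_iff_ne_empty]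
    rintro rfl
    exact h𝒳 0 (Nat.zero_le _) (hasPsdLift_empty_cube n 0)
  · have hkR : R₀ < k := by
      by_contra hle
      exact h𝒳 k (not_lt.1 hle) hk
    by_cases hk2 : k ≤ 2 ^ n
    · have := Nat.findGreatest_is_greatest hkR hk2
      exact not_lt.1 this
    · have hk1 : 2 ^ n ≤ k := by omega
      calc 2 ^ n ≤ k := hk1
        _ = 1 * 1 * k ^ 1 := by ring
        _ ≤ 54 * n * k ^ 4 := by
          gcongr
          · norm_num
          · omega
          · norm_num

end ZeroOneSdpLift

open ZeroOneSdpLift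

/-- **Briët–Dadush–Pokutta 2015, Theorem 7** (Math. Program. 153 (2015) 179–199 = arXiv:1305.3268,
§4 p. 11, verbatim): "For any `n ∈ ℕ` there exists `𝒳 ⊆ {0,1}ⁿ` such that
`xc_SDP(conv(𝒳)) = Ω(2^{n/4} / (n log n)^{1/4})`."  Here `xc_SDP(K)` is the least size `r` of a
semidefinite extended formulation of `K` (their Def. 1: "`K = {x ∈ ℝⁿ | ∃Y ∈ S^r_+ : a_iᵀx + ⟨U_i,Y⟩ =
b_i ∀ i ∈ I}` … The size of a semidefinite EF is the size `r` of the positive semidefinite matrices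
`U_i`"), which for polytopes is the psd rank of any slack matrix (their Thm. 4, "Yannakakis's
Factorization Theorem for SDPs") and equivalently the least size of a psd lift `P = π(S^r_+ ∩ L)` in
the sense of Gouveia–Parrilo–Thomas / FGPRT eq. (3) (the tree's `HasPsdLift`; equivalence with the
psd rank of the slack matrix = `FawziEtAl2015_thm33_holds`). TYPED in that consumed form, reading
`f(n) = Ω(g(n))` as `∃ c > 0 ∃ n₀ ∀ n ≥ n₀, f(n) ≥ c·g(n)`: there are `c > 0` and `n₀` such that for
every `n ≥ n₀` some set `𝒳` of 0/1 vectors in `ℝⁿ` has `conv(𝒳)` admitting psd lifts only of sizes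
`k ≥ c · 2^{n/4} / (n log n)^{1/4}`. DISCHARGED below (`BrietDadushPokutta2014_thm7_holds`), with the
sharper logarithm-free form `ZeroOneSdpLift.exists_zeroOne_two_pow_le_mul_pow_four`.
[cite: BrietDadushPokutta2014, Thm. 7 (§4, p. 11); Def. 1, Thm. 4 (§2, p. 5)] -/
def BrietDadushPokutta2014_thm7 : Prop :=
  ∃ c : ℝ, 0 < c ∧ ∃ n₀ : ℕ, ∀ n : ℕ, n₀ ≤ n → ∃ 𝒳 : Set (Fin n → ℝ),
    𝒳 ⊆ {x | ∀ i, x i = 0 ∨ x i = 1} ∧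
    ∀ k : ℕ, HasPsdLift (convexHull ℝ 𝒳) k →
      c * (2 : ℝ) ^ ((n : ℝ) / 4) / ((n : ℝ) * Real.log n) ^ ((1 : ℝ) / 4) ≤ k

/-- **DISCHARGE of `BrietDadushPokutta2014_thm7`** (with `c = 1/3`, `n₀ = 31`), from the counting
theorem `exists_zeroOne_two_pow_le_mul_pow_four` (`2ⁿ ≤ 54 n k⁴`) and `log n ≥ 1` for `n ≥ 3`.
[cite: BrietDadushPokutta2014, Thm. 7 (§4, p. 11)] -/
theorem BrietDadushPokutta2014_thm7_holds : BrietDadushPokutta2014_thm7 := by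
  refine ⟨1 / 3, by norm_num, 31, fun n hn => ?_⟩
  obtain ⟨𝒳, -, h𝒳⟩ := exists_zeroOne_two_pow_le_mul_pow_four hn
  refine ⟨cubePoint '' (𝒳 : Set (Fin n → Bool)), ?_, fun k hk => ?_⟩
  · rintro _ ⟨z, -, rfl⟩ i
    unfold cubePoint; split_ifs <;> simp
  have hnat := h𝒳 k hk
  have hreal : (2 : ℝ) ^ n ≤ 54 * n * (k : ℝ) ^ 4 := by exact_mod_cast hnat
  have hn0 : (0 : ℝ) < n := by exact_mod_cast (show 0 < n by omega)
  have hn3 : (3 : ℝ) ≤ n := by exact_mod_cast (show 3 ≤ n by omega)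
  have hlog : 1 ≤ Real.log n := by
    rw [Real.le_log_iff_exp_le hn0]
    exact (Real.exp_one_lt_d9.le.trans (by norm_num)).trans hn3
  have hk0 : (0 : ℝ) ≤ k := Nat.cast_nonneg k
  set A : ℝ := 1 / 3 * (2 : ℝ) ^ ((n : ℝ) / 4) / ((n : ℝ) * Real.log n) ^ ((1 : ℝ) / 4) with hA
  have hnl0 : (0 : ℝ) ≤ (n : ℝ) * Real.log n := by positivity
  have hA0 : 0 ≤ A := by rw [hA]; positivity
  rw [← pow_le_pow_iff_left₀ hA0 hk0 (by norm_num : (4 : ℕ) ≠ 0)]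
  have h2 : ((2 : ℝ) ^ ((n : ℝ) / 4)) ^ 4 = (2 : ℝ) ^ n := by
    rw [← Real.rpow_natCast ((2 : ℝ) ^ ((n : ℝ) / 4)) 4, ← Real.rpow_mul (by norm_num)]
    norm_num [Real.rpow_natCast]
  have hnl : (((n : ℝ) * Real.log n) ^ ((1 : ℝ) / 4)) ^ 4 = (n : ℝ) * Real.log n := by
    rw [one_div]
    exact Real.rpow_inv_natCast_pow hnl0 (by norm_num)
  have hA4 : A ^ 4 = (1 / 81) * (2 : ℝ) ^ n / ((n : ℝ) * Real.log n) := by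
    rw [hA, div_pow, mul_pow, h2, hnl]; norm_num
  rw [hA4]
  have hnl1 : (n : ℝ) ≤ (n : ℝ) * Real.log n := by
    calc (n : ℝ) = n * 1 := (mul_one _).symm
      _ ≤ n * Real.log n := by gcongr
  calc 1 / 81 * (2 : ℝ) ^ n / ((n : ℝ) * Real.log n)
      ≤ 1 / 81 * (2 : ℝ) ^ n / (n : ℝ) := by
        apply div_le_div_of_nonneg_left (by positivity) hn0 hnl1
    _ ≤ 1 / 54 * (2 : ℝ) ^ n / (n : ℝ) := by gcongr; norm_num
    _ = (2 : ℝ) ^ n / (54 * n) := by ring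
    _ ≤ (k : ℝ) ^ 4 := by
        rw [div_le_iff₀ (by positivity)]
        calc (2 : ℝ) ^ n ≤ 54 * n * (k : ℝ) ^ 4 := hreal
          _ = (k : ℝ) ^ 4 * (54 * n) := by ring

/-- **Theorem 7 in slack-matrix language** (via Thm. 4 / FGPRT Thm. 3.3 = `FawziEtAl2015_thm33_holds`):
for `n ≥ 31` there is a nonempty `𝒳 ⊆ {0,1}ⁿ` such that for EVERY H-description
`conv(𝒳) = {y : a_jᵀy ≤ b_j}` and every enumeration `x` of `𝒳`, each psd factorization of the slack
matrix `(b_j − a_jᵀx_i)` of size `k ≥ 1` has `2ⁿ ≤ 54·n·k⁴` ("`rank_PSD(S) = xc_SDP(P)` … the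
semidefinite rank of all slack matrices of `P` is identical", p. 5).
[cite: BrietDadushPokutta2014, Thm. 7 (§4, p. 11); Thm. 4 (§2, p. 5)] -/
theorem exists_zeroOne_slack_psdRank {n : ℕ} (hn : 31 ≤ n) :
    ∃ 𝒳 : Finset (Fin n → Bool), 𝒳.Nonempty ∧
      ∀ (v f k : ℕ) (x : Fin v → (Fin n → ℝ)) (a : Fin f → (Fin n → ℝ)) (b : Fin f → ℝ),
        1 ≤ k → Set.range x = cubePoint '' (𝒳 : Set (Fin n → Bool)) →
        convexHull ℝ (Set.range x) = {y | ∀ j, a j ⬝ᵥ y ≤ b j} →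
        HasPsdFactorization (pairSlackMatrix x a b) k → 2 ^ n ≤ 54 * n * k ^ 4 := by
  obtain ⟨𝒳, hne, h𝒳⟩ := exists_zeroOne_two_pow_le_mul_pow_four hn
  refine ⟨𝒳, hne, fun v f k x a b hk hx hdesc hfac => h𝒳 k ?_⟩
  rw [← hx]
  exact (FawziEtAl2015_thm33_holds n v f k x a b hk hdesc).1 hfac

/-! ## Part II. The LP original: Rothvoß 2013, Theorem 4 (some 0/1 polytopes need extended
formulations of size `2^{n/2·(1−o(1))}`) by the same counting, with vectors in place of matrices -/

namespace ZeroOneLpEF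

open ZeroOneSdpLift Literature.Barriers.PneNP

variable {n : ℕ} (𝒳 : Finset (Fin n → Bool))

/-! ### L3. From an extended formulation to normalised nonnegative factors (Yannakakis + Rothvoß's Lemma 2) -/

/-- **Normalised nonnegative factors.** If `conv(𝒳)` has a slack-form extended formulation with
`r` inequalities, the slacks of the system attached to `𝒳` factor as `b_j − a_jᵀx = Σ_i T_x(i) U_j(i)`
over `r + 1` coordinates with `0 ≤ T ≤ 1` and `0 ≤ U ≤ 2n` (Yannakakis' theorem, tree
`HasEFOfSize.exists_nonneg_factorization`, then the column/row rescaling "we may scale the rows and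
columns such that `‖U^ℓ‖_∞ = ‖V_ℓ‖_∞`" of the printed Lemma 2, here to `‖V_ℓ‖_∞ ≤ 1`).
[cite: Rothvoss2013, Thm. 1 and Lemma 2 (§3–§4, pp. 5–6)] -/
theorem exists_bounded_nonneg_factors (hn : 1 ≤ n) {r : ℕ}
    (h : HasEFOfSize (convexHull ℝ (cubePoint '' (𝒳 : Set (Fin n → Bool)))) r) :
    ∃ (T : 𝒳 → Option (Fin r) → ℝ) (U : Row n 𝒳 → Option (Fin r) → ℝ),
      (∀ x i, 0 ≤ T x i ∧ T x i ≤ 1) ∧ (∀ j i, 0 ≤ U j i ∧ U j i ≤ 2 * n) ∧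
      ∀ (x : 𝒳) (j : Row n 𝒳), rowRhs 𝒳 j - rowVec 𝒳 j ⬝ᵥ cubePoint x.1 = ∑ i, T x i * U j i := by
  classical
  obtain ⟨U₀, T₀, hU₀, hT₀, hfac⟩ := h.exists_nonneg_factorization (fun x : 𝒳 => cubePoint x.1)
    (fun x => subset_convexHull ℝ _ ⟨x.1, by simp, rfl⟩) (rowVec 𝒳) (rowRhs 𝒳)
    (fun j y hy => convexHull_subset_polyhedron 𝒳 hy j)
  rcases (𝒳 : Finset (Fin n → Bool)).eq_empty_or_nonempty with h0 | hne
  · subst h0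
    exact ⟨fun _ _ => 0, fun _ _ => 0, fun x => (Finset.notMem_empty _ x.2).elim,
      fun j i => ⟨le_rfl, by positivity⟩, fun x => (Finset.notMem_empty _ x.2).elim⟩
  haveI : Nonempty (𝒳 : Type) := hne.coe_sort
  -- column maxima
  set m : Option (Fin r) → ℝ := fun i => Finset.univ.sup' Finset.univ_nonempty (fun x : 𝒳 => T₀ x i)
    with hm
  have hTm : ∀ x i, T₀ x i ≤ m i := fun x i => Finset.le_sup' (fun x : 𝒳 => T₀ x i) (Finset.mem_univ x)
  have hm0 : ∀ i, 0 ≤ m i := fun i => by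
    obtain ⟨x⟩ := (inferInstance : Nonempty (𝒳 : Type))
    exact (hT₀ x i).trans (hTm x i)
  have hmax : ∀ i, ∃ x : 𝒳, T₀ x i = m i := fun i => by
    obtain ⟨x, -, hx⟩ := Finset.exists_mem_eq_sup' Finset.univ_nonempty (fun x : 𝒳 => T₀ x i)
    exact ⟨x, hx.symm⟩
  refine ⟨fun x i => if m i = 0 then 0 else T₀ x i / m i, fun j i => U₀ j i * m i,
    fun x i => ?_, fun j i => ⟨mul_nonneg (hU₀ j i) (hm0 i), ?_⟩, fun x j => ?_⟩
  · by_cases hi : m i = 0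
    · simp [hi]
    · have hpos : 0 < m i := lt_of_le_of_ne (hm0 i) (Ne.symm hi)
      simp only [hi, if_false]
      exact ⟨div_nonneg (hT₀ x i) hpos.le, (div_le_one hpos).2 (hTm x i)⟩
  · obtain ⟨x, hx⟩ := hmax i
    have hslack := (slack_bounds 𝒳 hn (Finset.coe_mem x) j).2
    rw [hfac j x] at hslack
    calc U₀ j i * m i = U₀ j i * T₀ x i := by rw [hx]
      _ ≤ ∑ i', U₀ j i' * T₀ x i' :=
          Finset.single_le_sum (f := fun i' => U₀ j i' * T₀ x i')
            (fun i' _ => mul_nonneg (hU₀ j i') (hT₀ x i')) (Finset.mem_univ i)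
      _ ≤ 2 * n := hslack
  · rw [hfac j x]
    refine Finset.sum_congr rfl fun i _ => ?_
    by_cases hi : m i = 0
    · have : T₀ x i = 0 := le_antisymm (hi ▸ hTm x i) (hT₀ x i)
      simp [hi, this]
    · simp only [hi, if_false]
      field_simp

/-! ### L5. Parameters and rounding (vectors of length `r + 1`) -/

/-- `D' = n + r + 2`: dimension of the coefficient space `ℝⁿ × ℝ × ℝ^{r+1}` (printed: `|I| ≤ n + r`).
[cite: Rothvoss2013, Thm. 3 (§4, p. 6)] -/
def dimBound (n r : ℕ) : ℕ := n + r + 2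

/-- `1/η' = 2(r+1)D'`. [cite: Rothvoss2013, Thm. 3 (§4, p. 6: "rounded … to the nearest multiple of 1/(4r(n+r)Δ)")] -/
def gridInv (n r : ℕ) : ℕ := 2 * (r + 1) * dimBound n r

/-- The grid step `η' = 1/(2(r+1)D')`. [cite: Rothvoss2013, Thm. 3 (§4, p. 6)] -/
def gridStep (n r : ℕ) : ℝ := 1 / (gridInv n r : ℝ)

/-- `Q₀' = 4n(r+1)D'`: bound on the rounded entries `U/η' ≤ 2n · 2(r+1)D'`. [cite: Rothvoss2013, Thm. 3 (§4, p. 6: "‖Ū‖_∞ ≤ Δ")] -/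
def entryBound (n r : ℕ) : ℕ := 4 * n * (r + 1) * dimBound n r

/-- The tolerance `ε' = 1/(4D')` (printed `1/(4(n+r))`). [cite: Rothvoss2013, Thm. 3 (§4, p. 6)] -/
def tol (n r : ℕ) : ℝ := 1 / (4 * (dimBound n r : ℝ))

/-- `D' > 0`. [folklore] -/
private theorem dimBound_pos (n r : ℕ) : 0 < dimBound n r := by unfold dimBound; omega

/-- `1/η' > 0`. [folklore] -/
private theorem gridInv_pos (n r : ℕ) : 0 < gridInv n r := by
  unfold gridInv; have := dimBound_pos n r; positivity

/-- Rounding to the grid: `round(u/η')`. [cite: Rothvoss2013, Thm. 3 (§4, p. 6)] -/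
def roundZ (n r : ℕ) (u : ℝ) : ℤ := round (u * (gridInv n r : ℝ))

/-- Rounding moves an entry by at most `η'/2`. [cite: Rothvoss2013, Thm. 3 (§4, p. 6: "‖U − U'‖_∞ ≤ …")] -/
theorem abs_sub_roundZ_mul (n r : ℕ) (u : ℝ) :
    |u - (roundZ n r u : ℝ) * gridStep n r| ≤ gridStep n r / 2 := by
  have hg : (0 : ℝ) < gridInv n r := by exact_mod_cast gridInv_pos n r
  have h := abs_sub_round (u * (gridInv n r : ℝ))
  have hη : gridStep n r = 1 / (gridInv n r : ℝ) := rfl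
  have : u - (roundZ n r u : ℝ) * gridStep n r
      = (u * (gridInv n r : ℝ) - round (u * (gridInv n r : ℝ))) * gridStep n r := by
    rw [hη, roundZ]; field_simp
  have hηpos : 0 < gridStep n r := by rw [hη]; positivity
  rw [this, abs_mul, abs_of_pos hηpos, hη]
  calc |u * ↑(gridInv n r) - ↑(round (u * ↑(gridInv n r)))| * (1 / ↑(gridInv n r))
      ≤ (1 / 2) * (1 / ↑(gridInv n r)) := by gcongr
    _ = 1 / ↑(gridInv n r) / 2 := by ring

/-- If `0 ≤ u ≤ 2n` then `0 ≤ round(u/η') ≤ Q₀'`. [cite: Rothvoss2013, Thm. 3 (§4, p. 6)] -/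
theorem roundZ_bounds {n r : ℕ} {u : ℝ} (hu0 : 0 ≤ u) (hu : u ≤ 2 * n) :
    0 ≤ roundZ n r u ∧ roundZ n r u ≤ (entryBound n r : ℤ) := by
  have hQ : (2 * n : ℝ) * (gridInv n r : ℝ) = (entryBound n r : ℝ) := by
    simp only [gridInv, entryBound, dimBound]; push_cast; ring
  have hx2 : u * (gridInv n r : ℝ) ≤ (entryBound n r : ℝ) := by
    rw [← hQ]; exact mul_le_mul_of_nonneg_right hu (Nat.cast_nonneg (α := ℝ) (gridInv n r))
  have hx1 : 0 ≤ u * (gridInv n r : ℝ) := mul_nonneg hu0 (Nat.cast_nonneg (α := ℝ) _)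
  rw [roundZ, round_eq]
  constructor
  · rw [Int.le_floor]; push_cast; linarith
  · have : ⌊u * ↑(gridInv n r) + 1 / 2⌋ < (entryBound n r : ℤ) + 1 := by
      rw [Int.floor_lt]; push_cast; linarith
    omega

/-- `|Σ_i E_i y_i| ≤ (r+1) δ` when `|y_i| ≤ 1` and `|E_i| ≤ δ`. [folklore] -/
private theorem abs_sum_mul_le {r : ℕ} {y E : Option (Fin r) → ℝ} {δ : ℝ}
    (hy : ∀ i, |y i| ≤ 1) (hE : ∀ i, |E i| ≤ δ) :
    |∑ i, y i * E i| ≤ ((r : ℝ) + 1) * δ := by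
  calc |∑ i, y i * E i| ≤ ∑ i, |y i * E i| := abs_sum_le_sum_abs _ _
    _ ≤ ∑ _i : Option (Fin r), δ := sum_le_sum fun i _ => by
        rw [abs_mul]
        calc |y i| * |E i| ≤ 1 * δ := mul_le_mul (hy i) (hE i) (abs_nonneg _) zero_le_one
          _ = δ := one_mul δ
    _ = ((r : ℝ) + 1) * δ := by simp [Fintype.card_option]

/-! ### L6. Codes and decoding -/

/-- The code of one row: `a` (shifted), `b` (shifted), rounded nonnegative entries `round(U_i/η') ∈ [0, Q₀']`.
[cite: Rothvoss2013, Thm. 4 (§4, p. 7, proof: "the domain for each entry contains at most … values")] -/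
abbrev RowCode (n r : ℕ) : Type :=
  (Fin n → Fin 3) × Fin (n + 3) × (Option (Fin r) → Fin (entryBound n r + 1))

/-- A code: the number `d ≤ D'` of selected rows and `D'` row codes.
[cite: Rothvoss2013, Thm. 4 (§4, p. 7, proof: "systems (Ā, Ū, b̄)")] -/
abbrev Code (n r : ℕ) : Type := Fin (dimBound n r + 1) × (Fin (dimBound n r) → RowCode n r)

variable {r : ℕ}

/-- The normal vector a row code stands for. [cite: Rothvoss2013, Thm. 3 (§4, p. 6)] -/
def RowCode.vec (c : RowCode n r) : Fin n → ℝ := fun i => ((c.1 i : ℕ) : ℝ) - 1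

/-- The right-hand side a row code stands for. [cite: Rothvoss2013, Thm. 3 (§4, p. 6)] -/
def RowCode.rhs (c : RowCode n r) : ℝ := ((c.2.1 : ℕ) : ℝ) - 1

/-- The rounded nonnegative row `Ū` a row code stands for. [cite: Rothvoss2013, Thm. 3 (§4, p. 6)] -/
def RowCode.uvec (c : RowCode n r) : Option (Fin r) → ℝ :=
  fun i => ((c.2.2 i : ℕ) : ℝ) * gridStep n r

/-- Admissible membership certificates `y ∈ [0,1]^{r+1}` (printed `y ∈ [0, Δ]^r`; here after
normalisation). [cite: Rothvoss2013, Thm. 3 (§4, p. 6, the set Y)] -/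
def Admissible (y : Option (Fin r) → ℝ) : Prop := ∀ i, 0 ≤ y i ∧ y i ≤ 1

/-- The decoding test value `b̄_i − Ā_i x − Ū_i y`. [cite: Rothvoss2013, Thm. 3 (§4, p. 6, the set Y)] -/
def testVal (c : RowCode n r) (z : Fin n → Bool) (y : Option (Fin r) → ℝ) : ℝ :=
  c.rhs - c.vec ⬝ᵥ cubePoint z - ∑ i, y i * c.uvec i

/-- **Decoding** (the set `Y` of the printed Theorem 3). [cite: Rothvoss2013, Thm. 3 (§4, p. 6, the set Y)] -/
def decode (c : Code n r) : Finset (Fin n → Bool) :=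
  @Finset.filter _ (fun z => ∃ y : Option (Fin r) → ℝ, Admissible y ∧
    ∀ t : Fin (dimBound n r), (t : ℕ) < (c.1 : ℕ) → |testVal (c.2 t) z y| ≤ tol n r)
    (Classical.decPred _) univ

/-- Membership in the decoded set. [cite: Rothvoss2013, Thm. 3 (§4, p. 6, the set Y)] -/
theorem mem_decode {c : Code n r} {z : Fin n → Bool} :
    z ∈ decode c ↔ ∃ y : Option (Fin r) → ℝ, Admissible y ∧
      ∀ t : Fin (dimBound n r), (t : ℕ) < (c.1 : ℕ) → |testVal (c.2 t) z y| ≤ tol n r := by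
  simp [decode]

/-- The number of codes. [cite: Rothvoss2013, Thm. 4 (§4, p. 7, proof)] -/
theorem card_code (n r : ℕ) :
    Fintype.card (Code n r) =
      (dimBound n r + 1) * (3 ^ n * (n + 3) * (entryBound n r + 1) ^ (r + 1)) ^ dimBound n r := by
  simp only [Code, RowCode, Fintype.card_prod, Fintype.card_pi, Fintype.card_fin, prod_const,
    card_univ, Fintype.card_option]
  ring

/-! ### L7. Encoding -/

/-- Encoding of a row from its integer data `(a, b, round(U/η'))`. [cite: Rothvoss2013, Thm. 3 (§4, p. 6)] -/
def encodeRow (a : Fin n → ℤ) (b : ℤ) (q : Option (Fin r) → ℤ) : RowCode n r :=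
  (fun i => clampFin 3 (by norm_num) (a i + 1), clampFin (n + 3) (by omega) (b + 1),
    fun i => clampFin (entryBound n r + 1) (by omega) (q i))

/-- Decoding the normal of an encoded row. [cite: Rothvoss2013, Thm. 3 (§4, p. 6)] -/
theorem encodeRow_vec {a : Fin n → ℤ} (ha : ∀ i, |a i| ≤ 1) (b : ℤ) (q : Option (Fin r) → ℤ) :
    (encodeRow a b q).vec = fun i => (a i : ℝ) := by
  funext i
  have h := abs_le.1 (ha i)
  have := clampFin_val (m := 3) (by norm_num) (x := a i + 1) (by omega) (by omega)
  simp only [RowCode.vec, encodeRow]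
  have : ((clampFin 3 (by norm_num) (a i + 1) : ℕ) : ℝ) = ((a i + 1 : ℤ) : ℝ) := by
    exact_mod_cast this
  rw [this]; push_cast; ring

/-- Decoding the right-hand side of an encoded row. [cite: Rothvoss2013, Thm. 3 (§4, p. 6)] -/
theorem encodeRow_rhs (a : Fin n → ℤ) {b : ℤ} (hb : -1 ≤ b ∧ b ≤ (n : ℤ) + 1)
    (q : Option (Fin r) → ℤ) : (encodeRow a b q).rhs = (b : ℝ) := by
  have := clampFin_val (m := n + 3) (by omega) (x := b + 1) (by omega) (by omega)
  simp only [RowCode.rhs, encodeRow]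
  have : ((clampFin (n + 3) (by omega) (b + 1) : ℕ) : ℝ) = ((b + 1 : ℤ) : ℝ) := by
    exact_mod_cast this
  rw [this]; push_cast; ring

/-- Decoding the rounded row of an encoded row. [cite: Rothvoss2013, Thm. 3 (§4, p. 6)] -/
theorem encodeRow_uvec (a : Fin n → ℤ) (b : ℤ) {q : Option (Fin r) → ℤ}
    (hq : ∀ i, 0 ≤ q i ∧ q i ≤ (entryBound n r : ℤ)) :
    (encodeRow a b q).uvec = fun i => (q i : ℝ) * gridStep n r := by
  funext i
  have h := hq i
  have := clampFin_val (m := entryBound n r + 1) (by omega) (x := q i) h.1 (by omega)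
  simp only [RowCode.uvec, encodeRow]
  have : ((clampFin (entryBound n r + 1) (by omega) (q i) : ℕ) : ℝ) = ((q i : ℤ) : ℝ) := by
    exact_mod_cast this
  rw [this]

/-- Linear combinations pass through the pairing `U ↦ Σ_i y_i U_i`. [folklore] -/
private theorem sum_mul_sum_smul {d : ℕ} (ν : Fin d → ℝ) (V : Fin d → Option (Fin r) → ℝ)
    (y : Option (Fin r) → ℝ) : ∑ i, y i * (∑ t, ν t • V t) i = ∑ t, ν t * ∑ i, y i * V t i := by
  simp only [Finset.sum_apply, Pi.smul_apply, smul_eq_mul, Finset.mul_sum]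
  rw [Finset.sum_comm]
  refine Finset.sum_congr rfl fun t _ => Finset.sum_congr rfl fun i _ => ?_
  ring

/-- The dimension of the coefficient space `ℝⁿ × ℝ × ℝ^{r+1}` is `D' = n + r + 2`. [folklore] -/
private theorem finrank_coeffSpace (n r : ℕ) :
    Module.finrank ℝ ((Fin n → ℝ) × ℝ × (Option (Fin r) → ℝ)) = dimBound n r := by
  simp only [Module.finrank_prod, Module.finrank_self, Module.finrank_fintype_fun_eq_card,
    Fintype.card_option, Fintype.card_fin, dimBound]
  ring

/-- `(r+1) · η'/2 = ε'`. [folklore] -/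
private theorem succ_mul_half_gridStep (n r : ℕ) :
    ((r : ℝ) + 1) * (gridStep n r / 2) = tol n r := by
  have hD : (dimBound n r : ℝ) ≠ 0 := by exact_mod_cast (dimBound_pos n r).ne'
  simp only [gridStep, tol, gridInv]
  push_cast
  field_simp
  ring

/-- **Encoding (injectivity).** If `conv(𝒳)` has an extended formulation of size `r` then some
code decodes to exactly `𝒳` — the identity `X = Y` of the printed Theorem 3: members pass the test
with their own normalised column `y = V^j`; a non-member violates its separator by `1`, `U_ℓ y ≥ 0`,
and the `[-1,1]`-combination over the selected rows (Cramer) forces one selected test value above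
`1/D' − ε' > ε'`. [cite: Rothvoss2013, Thm. 3 (§4, pp. 6–7, proof)] -/
theorem exists_code_decode_eq (hn : 1 ≤ n)
    (h : HasEFOfSize (convexHull ℝ (cubePoint '' (𝒳 : Set (Fin n → Bool)))) r) :
    ∃ c : Code n r, decode c = 𝒳 := by
  classical
  obtain ⟨T, U, hT, hU, hTU⟩ := exists_bounded_nonneg_factors 𝒳 hn h
  set w : Row n 𝒳 → (Fin n → ℝ) × ℝ × (Option (Fin r) → ℝ) :=
    fun j => (rowVec 𝒳 j, rowRhs 𝒳 j, U j) with hw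
  obtain ⟨d, sel, hd, hcoef⟩ := exists_subfamily_coeff_le_one w
  rw [finrank_coeffSpace] at hd
  set q : Row n 𝒳 → Option (Fin r) → ℤ := fun j i => roundZ n r (U j i) with hq
  set Ubar : Row n 𝒳 → Option (Fin r) → ℝ := fun j i => (q j i : ℝ) * gridStep n r with hUbar
  have hUerr : ∀ j i, |(U j - Ubar j) i| ≤ gridStep n r / 2 := fun j i => by
    rw [Pi.sub_apply]; exact abs_sub_roundZ_mul n r (U j i)
  have hqb : ∀ j i, 0 ≤ q j i ∧ q j i ≤ (entryBound n r : ℤ) := fun j i =>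
    roundZ_bounds (hU j i).1 (hU j i).2
  have herr : ∀ j (y : Option (Fin r) → ℝ), Admissible y →
      |∑ i, y i * (U j - Ubar j) i| ≤ tol n r := fun j y hy => by
    rw [← succ_mul_half_gridStep n r]
    exact abs_sum_mul_le (fun i => abs_le.2 ⟨by linarith [(hy i).1], (hy i).2⟩) (hUerr j)
  let row : Fin d → RowCode n r := fun t =>
    encodeRow (rowVecZ 𝒳 (sel t)) (rowRhsZ 𝒳 (sel t)) (q (sel t))
  let row₀ : RowCode n r := encodeRow (fun _ => 0) 0 (fun _ => 0)
  let c : Code n r := (⟨d, by omega⟩, fun t => if ht : (t : ℕ) < d then row ⟨t, ht⟩ else row₀)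
  have hrow_vec : ∀ t, (row t).vec = rowVec 𝒳 (sel t) := fun t =>
    encodeRow_vec (rowVecZ_abs_le 𝒳 (sel t)) _ _
  have hrow_rhs : ∀ t, (row t).rhs = rowRhs 𝒳 (sel t) := fun t =>
    encodeRow_rhs _ (rowRhsZ_bounds 𝒳 (sel t)) _
  have hrow_uvec : ∀ t, (row t).uvec = Ubar (sel t) := fun t => by
    rw [show row t = encodeRow (rowVecZ 𝒳 (sel t)) (rowRhsZ 𝒳 (sel t)) (q (sel t)) from rfl,
      encodeRow_uvec _ _ (hqb (sel t))]
  have hc2 : ∀ (t : ℕ) (ht : t < d), c.2 ⟨t, lt_of_lt_of_le ht hd⟩ = row ⟨t, ht⟩ := fun t ht => by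
    simp [c, dif_pos ht]
  have htest : ∀ (t : Fin d) (z : Fin n → Bool) (y : Option (Fin r) → ℝ),
      testVal (row t) z y =
        (rowRhs 𝒳 (sel t) - rowVec 𝒳 (sel t) ⬝ᵥ cubePoint z - ∑ i, y i * U (sel t) i)
          + ∑ i, y i * (U (sel t) - Ubar (sel t)) i := by
    intro t z y
    rw [testVal, hrow_vec, hrow_rhs, hrow_uvec]
    simp only [Pi.sub_apply, mul_sub, Finset.sum_sub_distrib]
    ring
  refine ⟨c, ?_⟩
  ext z
  rw [mem_decode]
  constructor
  · rintro ⟨y, hyadm, hytest⟩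
    by_contra hz
    set j : Row n 𝒳 := Sum.inl ⟨z, hz⟩ with hj
    obtain ⟨ν, hν, hwj⟩ := hcoef j
    have h1 : rowVec 𝒳 j = ∑ t, ν t • rowVec 𝒳 (sel t) := by
      have := congrArg Prod.fst hwj
      simpa [hw, Prod.fst_sum] using this
    have h2 : rowRhs 𝒳 j = ∑ t, ν t * rowRhs 𝒳 (sel t) := by
      have := congrArg (fun p => p.2.1) hwj
      simpa [hw, Prod.snd_sum, Prod.fst_sum] using this
    have h3 : U j = ∑ t, ν t • U (sel t) := by
      have := congrArg (fun p => p.2.2) hwj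
      simpa [hw, Prod.snd_sum] using this
    set S : Fin d → ℝ := fun t =>
      rowRhs 𝒳 (sel t) - rowVec 𝒳 (sel t) ⬝ᵥ cubePoint z - ∑ i, y i * U (sel t) i with hS
    have hcomb : rowRhs 𝒳 j - rowVec 𝒳 j ⬝ᵥ cubePoint z - ∑ i, y i * U j i = ∑ t, ν t * S t := by
      rw [h1, h2, h3, sum_smul_dotProduct, sum_mul_sum_smul, ← Finset.sum_sub_distrib,
        ← Finset.sum_sub_distrib]
      refine Finset.sum_congr rfl fun t _ => ?_
      rw [hS]; ring
    have hneg : rowRhs 𝒳 j - rowVec 𝒳 j ⬝ᵥ cubePoint z = -1 := rowRhs_sub_dotProduct_self 𝒳 ⟨z, hz⟩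
    have hpos : 0 ≤ ∑ i, y i * U j i :=
      Finset.sum_nonneg fun i _ => mul_nonneg (hyadm i).1 (hU j i).1
    have hone : 1 ≤ ∑ t, |S t| := by
      have hle : ∑ t, ν t * S t ≤ -1 := by rw [← hcomb]; linarith
      calc (1 : ℝ) ≤ |∑ t, ν t * S t| := by
            rw [abs_of_nonpos (by linarith)]; linarith
        _ ≤ ∑ t, |ν t * S t| := abs_sum_le_sum_abs _ _
        _ ≤ ∑ t, |S t| := sum_le_sum fun t _ => by
            rw [abs_mul]
            exact mul_le_of_le_one_left (abs_nonneg _) (hν t)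
    have hdpos : 0 < d := by
      by_contra hd0
      have hd0' : d = 0 := by omega
      subst hd0'
      rw [Fintype.sum_empty] at hone
      linarith
    have hDpos : (0 : ℝ) < dimBound n r := by exact_mod_cast dimBound_pos n r
    obtain ⟨t, -, ht⟩ : ∃ t ∈ (univ : Finset (Fin d)), 1 / (dimBound n r : ℝ) ≤ |S t| := by
      apply Finset.exists_le_of_sum_le (univ_nonempty_iff.2 ⟨⟨0, hdpos⟩⟩)
      rw [Finset.sum_const, Finset.card_univ, Fintype.card_fin, nsmul_eq_mul, mul_one_div]
      calc (d : ℝ) / dimBound n r ≤ 1 := by rw [div_le_one hDpos]; exact_mod_cast hd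
        _ ≤ ∑ t, |S t| := hone
    have hyt := hytest ⟨t, lt_of_lt_of_le t.2 hd⟩ t.2
    rw [hc2 t t.2, Fin.eta, htest t z y] at hyt
    have he := herr (sel t) y hyadm
    have hSle : |S t| ≤ tol n r + tol n r := by
      have := abs_add_le (S t + ∑ i, y i * (U (sel t) - Ubar (sel t)) i)
        (-(∑ i, y i * (U (sel t) - Ubar (sel t)) i))
      rw [add_neg_cancel_right, abs_neg] at this
      linarith
    have htol4 : tol n r = (1 / (dimBound n r : ℝ)) / 4 := by rw [tol]; ring
    have hp : 0 < 1 / (dimBound n r : ℝ) := by positivity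
    rw [htol4] at hSle
    linarith
  · intro hz
    refine ⟨T ⟨z, hz⟩, fun i => hT _ i, fun t ht => ?_⟩
    have ht' : (t : ℕ) < d := by simpa [c] using ht
    have hct : c.2 t = row ⟨t, ht'⟩ := by
      have := hc2 t ht'; simpa using this
    have hzero : rowRhs 𝒳 (sel ⟨t, ht'⟩) - rowVec 𝒳 (sel ⟨t, ht'⟩) ⬝ᵥ cubePoint z
        - ∑ i, T ⟨z, hz⟩ i * U (sel ⟨t, ht'⟩) i = 0 := by
      rw [hTU ⟨z, hz⟩ (sel ⟨t, ht'⟩)]; ring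
    rw [hct, htest, hzero, zero_add]
    exact herr _ _ (fun i => hT _ i)

/-! ### L8. Counting -/

/-- If every vertex set has an EF of size `r`, decoding is onto: `2^(2^n) ≤ #codes`.
[cite: Rothvoss2013, Thm. 4 (§4, p. 7, proof: "By injectivity of Φ, the number of sets X … cannot be larger than the number of systems")] -/
theorem two_pow_two_pow_le_card_code (hn : 1 ≤ n)
    (hall : ∀ 𝒳 : Finset (Fin n → Bool),
      HasEFOfSize (convexHull ℝ (cubePoint '' (𝒳 : Set (Fin n → Bool)))) r) :
    2 ^ (2 ^ n) ≤ Fintype.card (Code n r) := by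
  classical
  have hsurj : Function.Surjective (decode : Code n r → Finset (Fin n → Bool)) := fun 𝒳 =>
    exists_code_decode_eq 𝒳 hn (hall 𝒳)
  have := Fintype.card_le_of_surjective _ hsurj
  rwa [Fintype.card_finset, Fintype.card_fun, Fintype.card_bool, Fintype.card_fin] at this

/-- `96 n³ < 2ⁿ` for `n ≥ 20`. [folklore] -/
private theorem ninetysix_mul_pow_three_lt_two_pow {n : ℕ} (hn : 20 ≤ n) : 96 * n ^ 3 < 2 ^ n := by
  induction n, hn using Nat.le_induction with
  | base => norm_num
  | succ m hm ih =>
    have e3 : (m + 1) ^ 3 = m ^ 3 + 3 * m ^ 2 + 3 * m + 1 := by ring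
    have h2 : 20 * m ^ 2 ≤ m ^ 3 := by
      rw [pow_succ, mul_comm]; exact Nat.mul_le_mul_left _ hm
    have h1 : m ≤ m ^ 2 := by nlinarith
    have : (m + 1) ^ 3 ≤ 2 * m ^ 3 := by rw [e3]; nlinarith
    calc 96 * (m + 1) ^ 3 ≤ 96 * (2 * m ^ 3) := Nat.mul_le_mul_left _ this
      _ = 2 * (96 * m ^ 3) := by ring
      _ < 2 * 2 ^ m := by omega
      _ = 2 ^ (m + 1) := by rw [pow_succ]; ring

/-- The number of codes is at most `2^(96 n r²)` (`1 ≤ n ≤ r ≤ 2ⁿ`).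
[cite: Rothvoss2013, Thm. 4 (§4, p. 7, proof: "`(16Δ⁵)^{(n+R+1)(n+R)} ≤ 2^{C(n⁴ + n log(2n) R²)}`")] -/
theorem card_code_le_two_pow (hn : 1 ≤ n) (hnr : n ≤ r) (hr2 : r ≤ 2 ^ n) :
    Fintype.card (Code n r) ≤ 2 ^ (96 * n * r ^ 2) := by
  rw [card_code]
  have hr : 1 ≤ r := hn.trans hnr
  have hD4 : dimBound n r ≤ 4 * r := by unfold dimBound; omega
  have hn2 : n + 1 ≤ 2 ^ n := Nat.lt_two_pow_self
  have hr1 : r + 1 ≤ 2 ^ (n + 1) := by rw [pow_succ]; omega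
  have hD2 : dimBound n r ≤ 2 ^ (n + 2) := by
    have : 2 ^ (n + 2) = 4 * 2 ^ n := by rw [pow_add]; ring
    omega
  have hnn : n ≤ 2 ^ n := by omega
  have hK : entryBound n r + 1 ≤ 2 ^ (3 * n + 6) := by
    unfold entryBound
    have : 4 * n * (r + 1) * dimBound n r ≤ 2 ^ (3 * n + 5) := by
      calc 4 * n * (r + 1) * dimBound n r = 4 * (n * ((r + 1) * dimBound n r)) := by ring
        _ ≤ 4 * (2 ^ n * (2 ^ (n + 1) * 2 ^ (n + 2))) := by gcongr
        _ = 2 ^ (3 * n + 5) := by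
          rw [show (4 : ℕ) = 2 ^ 2 by norm_num, ← pow_add, ← pow_add, ← pow_add]; ring_nf
    have h1 : 1 ≤ 2 ^ (3 * n + 5) := Nat.one_le_two_pow
    calc 4 * n * (r + 1) * dimBound n r + 1 ≤ 2 ^ (3 * n + 5) + 2 ^ (3 * n + 5) := by omega
      _ = 2 ^ (3 * n + 6) := by rw [pow_succ]; ring
  have h3 : 3 ^ n ≤ 2 ^ (2 * n) := by
    calc 3 ^ n ≤ 4 ^ n := Nat.pow_le_pow_left (by norm_num) n
      _ = 2 ^ (2 * n) := by rw [pow_mul]; norm_num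
  have hn3 : n + 3 ≤ 2 ^ (n + 2) := by
    have : 2 ^ (n + 2) = 4 * 2 ^ n := by rw [pow_add]; ring
    omega
  have hexp : 2 * n + (n + 2) + (3 * n + 6) * (r + 1) ≤ 23 * n * r := by nlinarith
  have hinner : 3 ^ n * (n + 3) * (entryBound n r + 1) ^ (r + 1) ≤ 2 ^ (23 * n * r) := by
    calc 3 ^ n * (n + 3) * (entryBound n r + 1) ^ (r + 1)
        ≤ 2 ^ (2 * n) * 2 ^ (n + 2) * (2 ^ (3 * n + 6)) ^ (r + 1) := by gcongr
      _ = 2 ^ (2 * n + (n + 2) + (3 * n + 6) * (r + 1)) := by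
          rw [← pow_mul, ← pow_add, ← pow_add]
      _ ≤ 2 ^ (23 * n * r) := Nat.pow_le_pow_right (by norm_num) hexp
  have hsq : r ^ 2 = r * r := sq r
  have hpowD : (3 ^ n * (n + 3) * (entryBound n r + 1) ^ (r + 1)) ^ dimBound n r
      ≤ 2 ^ (92 * n * r ^ 2) := by
    calc (3 ^ n * (n + 3) * (entryBound n r + 1) ^ (r + 1)) ^ dimBound n r
        ≤ (2 ^ (23 * n * r)) ^ dimBound n r := Nat.pow_le_pow_left hinner _
      _ = 2 ^ (23 * n * r * dimBound n r) := by rw [← pow_mul]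
      _ ≤ 2 ^ (92 * n * r ^ 2) := Nat.pow_le_pow_right (by norm_num) (by
          rw [hsq]
          calc 23 * n * r * dimBound n r ≤ 23 * n * r * (4 * r) := Nat.mul_le_mul_left _ hD4
            _ = 92 * n * (r * r) := by ring)
  have hD1 : dimBound n r + 1 ≤ 2 ^ (4 * n * r ^ 2) := by
    calc dimBound n r + 1 ≤ 2 ^ dimBound n r := Nat.lt_two_pow_self
      _ ≤ 2 ^ (4 * n * r ^ 2) := Nat.pow_le_pow_right (by norm_num) (by
          rw [hsq]
          calc dimBound n r ≤ 4 * r := hD4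
            _ = 4 * 1 * (r * 1) := by ring
            _ ≤ 4 * n * (r * r) := by gcongr)
  calc (dimBound n r + 1) * (3 ^ n * (n + 3) * (entryBound n r + 1) ^ (r + 1)) ^ dimBound n r
      ≤ 2 ^ (4 * n * r ^ 2) * 2 ^ (92 * n * r ^ 2) := Nat.mul_le_mul hD1 hpowD
    _ = 2 ^ (96 * n * r ^ 2) := by rw [← pow_add]; ring_nf

/-! ### L9. The theorems -/

/-- **Counting bound (LP).** If every `𝒳 ⊆ {0,1}ⁿ` has an extended formulation of `conv(𝒳)` with
`r` inequalities (`1 ≤ n ≤ r ≤ 2ⁿ`), then `2ⁿ ≤ 96·n·r²`. [cite: Rothvoss2013, Thm. 4 (§4, p. 7, proof)] -/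
theorem two_pow_le_of_forall_hasEFOfSize (hn : 1 ≤ n) (hnr : n ≤ r) (hr2 : r ≤ 2 ^ n)
    (hall : ∀ 𝒳 : Finset (Fin n → Bool),
      HasEFOfSize (convexHull ℝ (cubePoint '' (𝒳 : Set (Fin n → Bool)))) r) :
    2 ^ n ≤ 96 * n * r ^ 2 :=
  (Nat.pow_le_pow_iff_right (by norm_num)).1
    ((two_pow_two_pow_le_card_code hn hall).trans (card_code_le_two_pow hn hnr hr2))

/-- **Existence of a vertex set without small extended formulations.** If `1 ≤ n ≤ r` and
`96·n·r² < 2ⁿ`, some `𝒳 ⊆ {0,1}ⁿ` has NO extended formulation of `conv(𝒳)` of any size `k ≤ r`.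
[cite: Rothvoss2013, Thm. 4 (§4, p. 7)] -/
theorem exists_forall_not_hasEFOfSize (hn : 1 ≤ n) (hnr : n ≤ r) (hlt : 96 * n * r ^ 2 < 2 ^ n) :
    ∃ 𝒳 : Finset (Fin n → Bool), ∀ k ≤ r,
      ¬ HasEFOfSize (convexHull ℝ (cubePoint '' (𝒳 : Set (Fin n → Bool)))) k := by
  by_contra hcon
  push Not at hcon
  have hall : ∀ 𝒳 : Finset (Fin n → Bool),
      HasEFOfSize (convexHull ℝ (cubePoint '' (𝒳 : Set (Fin n → Bool)))) r := fun 𝒳 => by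
    obtain ⟨k, hk, h⟩ := hcon 𝒳
    exact h.of_le hk
  have hr2 : r ≤ 2 ^ n := by
    have h1 : r ≤ r ^ 2 := by nlinarith
    have h2 : r ^ 2 ≤ 96 * n * r ^ 2 := Nat.le_mul_of_pos_left _ (by omega)
    omega
  exact absurd (two_pow_le_of_forall_hasEFOfSize hn hnr hr2 hall) (not_le.2 hlt)

/-- **"Most 0/1 polytopes need large extended formulations"** — the quantitative content of the
counting proof: a family of vertex sets `𝒳 ⊆ {0,1}ⁿ` all of whose hulls have an EF with `r`
inequalities (`1 ≤ n ≤ r ≤ 2ⁿ`) has at most `2^{96 n r²}` members — out of `2^{2ⁿ}` vertex sets.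
[cite: Rothvoss2013, Thm. 4 (§4, p. 7, proof)] -/
theorem card_le_of_forall_hasEFOfSize (hn : 1 ≤ n) (hnr : n ≤ r) (hr2 : r ≤ 2 ^ n)
    (𝓕 : Finset (Finset (Fin n → Bool)))
    (h𝓕 : ∀ 𝒳 ∈ 𝓕, HasEFOfSize (convexHull ℝ (cubePoint '' (𝒳 : Set (Fin n → Bool)))) r) :
    𝓕.card ≤ 2 ^ (96 * n * r ^ 2) := by
  classical
  have hsub : 𝓕 ⊆ (Finset.univ : Finset (Code n r)).image decode := fun 𝒳 h𝒳 => by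
    obtain ⟨c, hc⟩ := exists_code_decode_eq 𝒳 hn (h𝓕 𝒳 h𝒳)
    exact Finset.mem_image.2 ⟨c, Finset.mem_univ _, hc⟩
  calc 𝓕.card ≤ ((Finset.univ : Finset (Code n r)).image decode).card := Finset.card_le_card hsub
    _ ≤ (Finset.univ : Finset (Code n r)).card := Finset.card_image_le
    _ = Fintype.card (Code n r) := Finset.card_univ
    _ ≤ 2 ^ (96 * n * r ^ 2) := card_code_le_two_pow hn hnr hr2

/-- The empty vertex set has an EF of size `0`. [folklore] -/
private theorem hasEFOfSize_empty_cube (n : ℕ) :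
    HasEFOfSize (convexHull ℝ (cubePoint '' ((∅ : Finset (Fin n → Bool)) : Set (Fin n → Bool)))) 0 := by
  classical
  have h := hasEFOfSize_convexHull_finset (ι := Fin n) (∅ : Finset (Fin n → ℝ))
  simp only [Finset.card_empty, Finset.coe_empty] at h
  simpa only [Finset.coe_empty, Set.image_empty] using h

/-- **Rothvoß 2013, Theorem 4 — explicit form without the logarithm.** For every `n ≥ 20` there is
a nonempty `𝒳 ⊆ {0,1}ⁿ` such that every slack-form extended formulation of `conv(𝒳)` with `k`
inequalities has `2ⁿ ≤ 96·n·k²`, i.e. `k ≥ (2ⁿ/(96 n))^{1/2}` (printed: `Ω(2^{n/2}/√(n log(2n)))`;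
the logarithm came from `Δ = (n+1)^{(n+1)/2}`, avoided by the `±1` separators).
[cite: Rothvoss2013, Thm. 4 (§4, p. 7)] -/
theorem exists_zeroOne_two_pow_le_mul_sq (hn : 20 ≤ n) :
    ∃ 𝒳 : Finset (Fin n → Bool), 𝒳.Nonempty ∧
      ∀ k : ℕ, HasEFOfSize (convexHull ℝ (cubePoint '' (𝒳 : Set (Fin n → Bool)))) k →
        2 ^ n ≤ 96 * n * k ^ 2 := by
  classical
  have hn1 : 1 ≤ n := by omega
  set P : ℕ → Prop := fun R => 96 * n * R ^ 2 < 2 ^ n with hP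
  set R₀ := Nat.findGreatest P (2 ^ n) with hR₀
  have hPn : P n := by
    show 96 * n * n ^ 2 < 2 ^ n
    calc 96 * n * n ^ 2 = 96 * n ^ 3 := by ring
      _ < 2 ^ n := ninetysix_mul_pow_three_lt_two_pow hn
  have hnR₀ : n ≤ R₀ := Nat.le_findGreatest (Nat.lt_two_pow_self).le hPn
  have hPR₀ : P R₀ := Nat.findGreatest_spec (P := P) (Nat.zero_le _) (by
    show 96 * n * 0 ^ 2 < 2 ^ n; simp)
  obtain ⟨𝒳, h𝒳⟩ := exists_forall_not_hasEFOfSize hn1 hnR₀ hPR₀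
  refine ⟨𝒳, ?_, fun k hk => ?_⟩
  · rw [Finset.nonempty_iff_ne_empty]
    rintro rfl
    exact h𝒳 0 (Nat.zero_le _) (hasEFOfSize_empty_cube n)
  · have hkR : R₀ < k := by
      by_contra hle
      exact h𝒳 k (not_lt.1 hle) hk
    by_cases hk2 : k ≤ 2 ^ n
    · have := Nat.findGreatest_is_greatest (P := P) hkR hk2
      exact not_lt.1 this
    · have hk1 : 2 ^ n ≤ k := by omega
      calc 2 ^ n ≤ k := hk1
        _ = 1 * 1 * k ^ 1 := by ring
        _ ≤ 96 * n * k ^ 2 := by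
          gcongr
          · norm_num
          · omega
          · norm_num

end ZeroOneLpEF

open ZeroOneLpEF Literature.Barriers.PneNP in
/-- **Rothvoß 2013, Theorem 4** (Math. Program. 142 (2013) 255–268 = arXiv:1105.0036, §4 p. 7,
verbatim): "For any `n ∈ ℕ`, there exists a set `X ⊆ {0,1}ⁿ` such that
`xc(conv(X)) ≥ Ω(2^{n/2} / √(n log(2n)))`."  Here (§3, p. 5) "An extension is a polyhedron `Q ⊆ ℝ^m`
together with a linear projection `p : ℝ^m → ℝⁿ` such that `p(Q) = P`. An extended formulation is a
description of `Q` with linear inequalities and equations … The size of the extended formulation is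
the number of inequalities in the description … the extension complexity `xc(P)` [is] the smallest
size of any extended formulation", which by Yannakakis' theorem (their Thm. 1) is the nonnegative
rank of any slack matrix, and equivalently the least size of a slack-form EF `E x + F y = g, y ≥ 0`
(FMPTW §1; the tree's `Literature.Barriers.PneNP.HasEFOfSize`). TYPED in that consumed form,
reading `Ω` as `∃ c > 0 ∃ n₀ ∀ n ≥ n₀`; DISCHARGED below (`Rothvoss2013_thm4_holds`), with the sharper
logarithm-free form `ZeroOneLpEF.exists_zeroOne_two_pow_le_mul_sq`.
[cite: Rothvoss2013, Thm. 4 (§4, p. 7); §3 and Thm. 1 (p. 5)] -/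
def Rothvoss2013_thm4 : Prop :=
  ∃ c : ℝ, 0 < c ∧ ∃ n₀ : ℕ, ∀ n : ℕ, n₀ ≤ n → ∃ 𝒳 : Set (Fin n → ℝ),
    𝒳 ⊆ {x | ∀ i, x i = 0 ∨ x i = 1} ∧
    ∀ k : ℕ, Literature.Barriers.PneNP.HasEFOfSize (convexHull ℝ 𝒳) k →
      c * (2 : ℝ) ^ ((n : ℝ) / 2) / Real.sqrt ((n : ℝ) * Real.log (2 * n)) ≤ k

open ZeroOneLpEF Literature.Barriers.PneNP in
/-- **DISCHARGE of `Rothvoss2013_thm4`** (with `c = 1/10`, `n₀ = 20`), from the counting theorem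
`ZeroOneLpEF.exists_zeroOne_two_pow_le_mul_sq` (`2ⁿ ≤ 96 n k²`) and `log(2n) ≥ 1` for `n ≥ 2`.
[cite: Rothvoss2013, Thm. 4 (§4, p. 7)] -/
theorem Rothvoss2013_thm4_holds : Rothvoss2013_thm4 := by
  refine ⟨1 / 10, by norm_num, 20, fun n hn => ?_⟩
  obtain ⟨𝒳, -, h𝒳⟩ := exists_zeroOne_two_pow_le_mul_sq hn
  refine ⟨cubePoint '' (𝒳 : Set (Fin n → Bool)), ?_, fun k hk => ?_⟩
  · rintro _ ⟨z, -, rfl⟩ i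
    unfold cubePoint; split_ifs <;> simp
  have hnat := h𝒳 k hk
  have hreal : (2 : ℝ) ^ n ≤ 96 * n * (k : ℝ) ^ 2 := by exact_mod_cast hnat
  have hn0 : (0 : ℝ) < n := by exact_mod_cast (show 0 < n by omega)
  have hn3 : (3 : ℝ) ≤ 2 * n := by
    have : (2 : ℝ) ≤ n := by exact_mod_cast (show 2 ≤ n by omega)
    linarith
  have hlog : 1 ≤ Real.log (2 * n) := by
    rw [Real.le_log_iff_exp_le (by linarith)]
    exact (Real.exp_one_lt_d9.le.trans (by norm_num)).trans hn3
  have hk0 : (0 : ℝ) ≤ k := Nat.cast_nonneg k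
  set A : ℝ := 1 / 10 * (2 : ℝ) ^ ((n : ℝ) / 2) / Real.sqrt ((n : ℝ) * Real.log (2 * n)) with hA
  have hnl0 : (0 : ℝ) < (n : ℝ) * Real.log (2 * n) := by positivity
  have hA0 : 0 ≤ A := by rw [hA]; positivity
  rw [← pow_le_pow_iff_left₀ hA0 hk0 (by norm_num : (2 : ℕ) ≠ 0)]
  have h2 : ((2 : ℝ) ^ ((n : ℝ) / 2)) ^ 2 = (2 : ℝ) ^ n := by
    rw [← Real.rpow_natCast ((2 : ℝ) ^ ((n : ℝ) / 2)) 2, ← Real.rpow_mul (by norm_num)]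
    norm_num [Real.rpow_natCast]
  have hnl : (Real.sqrt ((n : ℝ) * Real.log (2 * n))) ^ 2 = (n : ℝ) * Real.log (2 * n) :=
    Real.sq_sqrt hnl0.le
  have hA2 : A ^ 2 = (1 / 100) * (2 : ℝ) ^ n / ((n : ℝ) * Real.log (2 * n)) := by
    rw [hA, div_pow, mul_pow, h2, hnl]; norm_num
  rw [hA2]
  have hnl1 : (n : ℝ) ≤ (n : ℝ) * Real.log (2 * n) := by
    calc (n : ℝ) = n * 1 := (mul_one _).symm
      _ ≤ n * Real.log (2 * n) := by gcongr
  calc 1 / 100 * (2 : ℝ) ^ n / ((n : ℝ) * Real.log (2 * n))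
      ≤ 1 / 100 * (2 : ℝ) ^ n / (n : ℝ) := by
        apply div_le_div_of_nonneg_left (by positivity) hn0 hnl1
    _ ≤ 1 / 96 * (2 : ℝ) ^ n / (n : ℝ) := by gcongr; norm_num
    _ = (2 : ℝ) ^ n / (96 * n) := by ring
    _ ≤ (k : ℝ) ^ 2 := by
        rw [div_le_iff₀ (by positivity)]
        calc (2 : ℝ) ^ n ≤ 96 * n * (k : ℝ) ^ 2 := hreal
          _ = (k : ℝ) ^ 2 * (96 * n) := by ring

/-! ### Block lifts: `(S^d_+)^r`-lifts of most `0/1` polytopes need `d·r` exponential -/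

/-- **BDP Theorem 7 for `(S^d_+)^r`-lifts (block-diagonal SDPs, Fawzi–Parrilo's currency)**: the same `0/1`
polytopes need `d·r ≥ c·2^{n/4}/(n log n)^{1/4}` for every `(S^d_+)^r`-lift, since an `(S^d_+)^r`-lift is an
`S^{dr}_+`-lift (`HasBlockPsdLift.hasPsdLift`). [cite: BrietDadushPokutta2014, Thm. 7 (§4, p. 11)]
[cite: FawziParrilo2013, §1.1 (p. 3, "(S^d_+)^r ⊆ S^{rd}_+")] -/
theorem BrietDadushPokutta2014_thm7_blocks :
    ∃ c : ℝ, 0 < c ∧ ∃ n₀ : ℕ, ∀ n : ℕ, n₀ ≤ n → ∃ 𝒳 : Set (Fin n → ℝ),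
      𝒳 ⊆ {x | ∀ i, x i = 0 ∨ x i = 1} ∧
      ∀ d r : ℕ, HasBlockPsdLift (convexHull ℝ 𝒳) d r →
        c * (2 : ℝ) ^ ((n : ℝ) / 4) / ((n : ℝ) * Real.log n) ^ ((1 : ℝ) / 4) ≤ ((d * r : ℕ) : ℝ) := by
  obtain ⟨c, hc, n₀, H⟩ := BrietDadushPokutta2014_thm7_holds
  refine ⟨c, hc, n₀, fun n hn => ?_⟩
  obtain ⟨𝒳, h𝒳, hk⟩ := H n hn
  exact ⟨𝒳, h𝒳, fun d r h => hk (d * r) h.hasPsdLift⟩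

/-- The sharp log-free form for block lifts: for `n ≥ 31` some nonempty `𝒳 ⊆ {0,1}ⁿ` has `2ⁿ ≤ 54·n·(dr)⁴` for
every `(S^d_+)^r`-lift of `conv 𝒳` (as natural numbers). [cite: BrietDadushPokutta2014, Thm. 7 (§4, p. 11)]
[cite: FawziParrilo2013, §1.1 (p. 3)] -/
theorem ZeroOneSdpLift.exists_zeroOne_two_pow_le_blocks {n : ℕ} (hn : 31 ≤ n) :
    ∃ 𝒳 : Finset (Fin n → Bool), 𝒳.Nonempty ∧
      ∀ d r : ℕ, HasBlockPsdLift (convexHull ℝ (cubePoint '' (𝒳 : Set (Fin n → Bool)))) d r →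
        2 ^ n ≤ 54 * n * (d * r) ^ 4 := by
  obtain ⟨𝒳, hne, hk⟩ := ZeroOneSdpLift.exists_zeroOne_two_pow_le_mul_pow_four hn
  exact ⟨𝒳, hne, fun d r h => hk (d * r) h.hasPsdLift⟩

end Literature.Combinatorics.Optimization
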